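import Mathlib
import Literature.AlgebraicGeometry.DeterminantalHypersurfaces.NetzerPlaumannThom13HermiteMatrix
import Literature.LinearAlgebra.Matrix.CompanionMatrix
import HarnessLib

/-!
# Netzer–Plaumann–Thom 2013, §2–§3: determinantal representations from the Hermite matrix

Source: T. Netzer, D. Plaumann, A. Thom, *Determinantal representations and the Hermite matrix*,
Michigan Math. J. 62 (2013) 407–420 = arXiv:1108.4380 (held text `paper:arxiv-1108.4380`, whose
numbering we follow) [cite: NetzerPlaumannThom2013, §2 «A general construction method» and §3
«Rational representations of degree one»].  Continues
`NetzerPlaumannThom13HermiteMatrix.lean` (§1: `paramHermite p d = 𝓗(p)`, `homogenization p d = P`).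

Setup 2.4 of the source.  `p ∈ ℝ[x]` is a (real-zero) polynomial of degree `d` with `p(0) = 1`,
`P(x,t) = t^d p(x/t) = t^d + p_1t^{d−1} + ⋯ + p_d`, and a decomposition `q²𝓗(p) = 𝒬ᵀ𝒬` with
`q ∈ ℝ[x]` (homogeneous of degree `r`) and `𝒬 ∈ Mat_{k×d}(ℝ[x])` is FIXED (its existence for
real-zero `p`, Lemma 2.1, rests on the Gondard–Ribenboim matrix version of Hilbert's 17th problem and
is NOT formalised — see below).  `A = ℝ[x,t]/(P) ≅ ℝ[x]^d` carries the form
`⟨f,g⟩_p = fᵀ q²𝓗(p) g` and the `ℝ[x]`-linear map `𝓛_t` = multiplication by `t`, whose matrix in the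
basis `1, t, …, t^{d−1}` is the companion matrix of `P` (eq. (3)); `det(I − 𝓛_t) = p` (eq. (4)).

## Dictionary (source item → Lean → status)

| Source | Lean | Status |
|---|---|---|
| eq. (3): `𝓛_t` = companion matrix of `P` | `compCoeff`, `compL p d` (the tree's `Literature.LinearAlgebra.Matrix.companion`), `compL_apply`, `homogenization_eq_X_pow_add_sum`, `charpoly_compL` (`χ(𝓛_t) = P`, via the tree's `charpoly_companion`) | def + proved |
| eq. (4): `det(I − 𝓛_t) = p` | `det_one_sub_compL`, `eval_one_homogenization` | proved |
| Lemma 2.1 (homogeneous `q` with `q²𝓗(p) = 𝒬ᵀ𝒬`, from Gondard–Ribenboim 1974) | `minPart` (`𝒬_min`), `homogeneousComponent_eq_zero_of_gram` (degree structure of the columns of `𝒬`), `lemma_2_1_minPart` (`q_r²𝓗(p) = 𝒬_minᵀ𝒬_min`), `lemma_2_1_of_decomposition` | the source's own proof (making `q` homogeneous by lowest-degree parts, over `ℝ`) is typed and proved; its INPUT — the existence of some decomposition `q²𝓗(p) = 𝒬ᵀ𝒬` for real-zero `p` (Gondard–Ribenboim matrix Positivstellensatz) — is not in Mathlib, is NOT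 vendored as a fact, and is taken as a hypothesis by every later statement, exactly as Setup 2.4 fixes it |
| Lemma 2.2 (`𝓛_t` self-adjoint for `⟨·,·⟩_p`) | `lemma_2_2` (`𝓛_tᵀ𝓗(p) = 𝓗(p)𝓛_t`, any integral domain of coefficients), `lemma_2_2_bilin` (printed form), core `companion_transpose_mul_hermiteOfCoeff`, `vandermonde_mul_companion` (`V𝓛 = diag(μ)V`) | proved (via `𝓗 = VᵀV` over an algebraic closure instead of the printed Newton identity) |
| Lemma 2.3 (1) (`p` square-free ⇒ `𝒬` injective) | `lemma_2_3_1`; inputs `det_paramHermite_ne_zero` (Thm. 1.1: `𝓗(p)` nonsingular iff `P` separable over `ℝ(x)`; `det_hermiteOfCoeff_coeffSeq_ne_zero`) and `separable_homogenization_of_squarefree` (`Squarefree p ⇒ P` separable over `F(x)`: `squarefree_homogenizationOpt` by a degree count on `P̃ ∈ F[x,t]`, Gauss `squarefree_map_of_monic`, `PerfectField.separable_iff_squarefree`) | proved |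
| Lemma 2.3 (2) (`𝒬` is an isometry) | `lemma_2_3_2` | proved |
| Thm. 2.5 (main result: `𝓜𝒬 = 𝒬𝓛_t ⇒ p ∣ det(I − 𝓜)`) | `thm_2_5_matrix` (any `𝓜 ∈ Mat_k(F[x])`, `char F = 0`), `thm_2_5` (printed: `𝓜 = Σ xᵢMᵢ`), `thm_2_5_monicPencilDet` (tree normalisation `p ∣ monicPencilDet A` for `𝓜 = linPencil A`) | proved |
| Rem. 2.6, Rem. 2.7 (the linear system for `𝓜`) | — | prose / algorithmic, nothing to type |
| Example 2.8 (quadratics `p = xᵀAx + bᵀx + 1` with `bbᵀ − 4A = Σ vᵢvᵢᵀ ⪰ 0`: `𝓗(p) = 𝒬ᵀ𝒬`, `𝓛_t`, the symmetric linear `𝓜` with `𝓜𝒬 = 𝒬𝓛_t`, `det(I − 𝓜) = (1 + ½bᵀx)^{n−1} p`) | `ex28Q`, `ex28M`, `ex28M_isSymm`, `ex28Q_gram`, `compL_quadPoly`, `ex28_comm`, `one_sub_ex28M`, `ex28_det` (division-free `det(I − 𝓜)·(1 + ½bᵀx) = (1 + ½bᵀx)^n p`), `ex28_det'` (printed form,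 `n ≥ 1`), helper `det_arrow_mul` | def + proved |
| Example 2.9 (a real-zero cubic for which the linear system of Rem. 2.7 has no solution) | — | numerical, not typed |
| Thm. 3.1 (`𝓜 := q⁻²𝒬𝓛_t𝓗⁻¹𝒬ᵀ` over `ℝ(x)`: symmetric, homogeneous of degree `1`, `det(I − 𝓜) = p`) | `ratRep` (over any fraction field `K` of `F[x]`), `ratRep_isSymm`, `det_one_sub_ratRep`; degree clause: `IsHomogeneousRat` (§3's «`f/g` homogeneous, of degree `deg f − deg g`»), `paramHermite_isHomogeneous`, `det_paramHermite_isHomogeneous`, `adjugate_paramHermite_isHomogeneous`, `ratRep_numerator_isHomogeneous`, `ratRep_apply_mul_denominator`, `thm_3_1_isHomogeneousRat`; all clauses together: `thm_3_1` | proved (all three clauses; the degree clause by exhibiting `𝓜_{ij} = (𝒬𝓛_t adj𝓗 𝒬ᵀ)_{ij} / (q² det 𝓗)` as a quotient of forms instead of the printed scaling identities) |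
| Rem. 3.2 (algebraic certificate of the real-zero property), Example 3.3 | — | prose / numerical, not typed |
| Introduction, Theorem (`p` square-free real-zero ⇒ `p = det(I + 𝓜)` with symmetric rational homogeneous degree-one `𝓜`) | `intro_theorem_of_decomposition` (= Thm. 3.1 with `𝓜 ↦ −𝓜`, from a given decomposition `q²𝓗(p) = 𝒬ᵀ𝒬`, `q ≠ 0`) | proved relative to the decomposition (the Gondard–Ribenboim input of Lemma 2.1 is not formalised) |

## Typed-vs-printed

* **Hypotheses.** Thm. 2.5 / Lemma 2.3 / Thm. 3.1 are printed for `p ∈ ℝ[x]` square-free AND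
  real-zero, `q` homogeneous, `𝓜` homogeneous symmetric linear; the typed theorems keep exactly what
  the conclusions need: `Squarefree p`, `p(0) = 1` (`MvPolynomial.constantCoeff p = 1`),
  `deg p = d` (`p.totalDegree = d`), `q ≠ 0`, `𝒬ᵀ𝒬 = q² • 𝓗(p)`, and the commuting square; the base
  field is any `F` of characteristic `0` (printed: `ℝ`).  Dropped hypotheses are genuinely unused,
  so each typed statement implies the printed one.
* **Proof of Thm. 2.5.** Printed: for generic `a`, `𝒬(a)` is injective, so the eigenvalues of
  `𝓛_t(a)` are eigenvalues of `𝓜(a)`, hence `det(I − 𝓜)` vanishes on `{p = 0}`, and `(p)` is real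
  radical (Bochnak–Coste–Roy 4.5.1 (v)).  Typed: the same eigenvector transfer performed ONCE over an
  algebraic closure `L` of `F(x)` — `P` has `d` simple roots `μ_l` there (square-freeness), the
  columns of `𝒬V⁻¹` are `μ_l`-eigenvectors of `𝓜`, so `∏(t − μ_l) = P ∣ χ_𝓜` in `L[t]`, hence in
  `F[x][t]` (`P` monic, `Polynomial.map_dvd_map`), and `t ↦ 1` yields `p = P(x,1) ∣ χ_𝓜(1) = det(I − 𝓜)`.
  No real algebra is needed, which is why the real-zero hypothesis disappears.
* **Lemma 2.3 (1).** Printed: `𝓗(p)(a) ≻ 0` where `p(ta)` has distinct roots.  Typed: `det 𝓗(p) ≠ 0`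
  in `F[x]` because `P` is separable over `F(x)` (`Squarefree p ⇒ Squarefree P ⇒` Gauss `⇒`
  separable in characteristic `0`).
* **Thm. 3.1, degree clause.** §3 defines `f/g ∈ ℝ(x)` to be homogeneous when `f` and `g` are, of
  degree `deg f − deg g`; `IsHomogeneousRat φ e k` (`φ : F[x] → K`) is exactly this
  (`∃ f g` forms, `g ≠ 0`, `deg f − deg g = k`, `e·φ(g) = φ(f)`); the «equivalently,
  `(f/g)(λa) = λ^d (f/g)(a)`» reformulation is not typed.  The printed proof scales `a ↦ λa`; the
  typed proof reads off the degrees of `𝒬`, `𝓛_t`, `adj 𝓗(p)`, `det 𝓗(p)` (Leibniz) directly and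
  needs no hypothesis on `p` (when `q² det 𝓗(p) = 0`, `𝓜 = 0`).
* **Lemma 2.1.** Typed for a `q` with no homogeneous parts below degree `r` (then `q_r = ` the part of
  degree `r`); the printed `r` is the least degree of a part of `q`, recovered in
  `lemma_2_1_of_decomposition` by `Nat.find`.  The comparison of lowest-degree parts uses that a sum of
  squares of real polynomials vanishes only termwise (so the lemma is stated over `ℝ`).
* `𝓛_t`, `𝓗(p)`, `𝒬` are matrices over `F[x]` (`Fin d`/`Fin k` indexed); `⟨f,g⟩_p` is spelled
  `f ⬝ᵥ ((q^2 • paramHermite p d) *ᵥ g)`; «`𝒬` injective» is `Function.Injective 𝒬.mulVec`.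

Honest framing: dictionary literature for the V1 line (symmetric determinantal representations;
Hermite-matrix certificates); no route item is touched and nothing here bears on lower bounds for
the permanent.
-/

noncomputable section


namespace Literature.AlgebraicGeometry.DeterminantalHypersurfaces.NetzerPlaumannThom2013

open Polynomial Matrix Finset
open Literature.LinearAlgebra.Matrix (companion companion_apply charpoly_companion)
open Literature.AlgebraicGeometry.DeterminantalHypersurfaces.MonicPencilRealZero

/-! ## The companion matrix `𝓛_t` and the Hermite matrix: general algebra over a domain -/

section CompanionAlgebra

variable {R : Type*} [CommRing R]

/-- The coefficient sequence (in the format of `newtonOfCoeff` / `hermiteOfCoeff`) of the monic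
polynomial `t^d + Σ_{i<d} a_i t^i`: `c k = a_{d−k}` for `1 ≤ k ≤ d`, `0` beyond `d`.
[cite: NetzerPlaumannThom2013, §2 (Setup 2.4)] -/
def coeffSeq {d : ℕ} (a : Fin d → R) : ℕ → R := fun k =>
  if h : 1 ≤ k ∧ k ≤ d then a ⟨d - k, by omega⟩ else 0

/-- `coeffSeq` commutes with ring homomorphisms. [cite: NetzerPlaumannThom2013, §2 (Setup 2.4)] -/
theorem map_coeffSeq {S : Type*} [CommRing S] (f : R →+* S) {d : ℕ} (a : Fin d → R) (k : ℕ) :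
    f (coeffSeq a k) = coeffSeq (fun i => f (a i)) k := by
  unfold coeffSeq
  split_ifs <;> simp

/-- `coeffSeq a` lists the coefficients of `t^d + Σ a_i t^i`: `c k = coeff (d − k)` for `1 ≤ k ≤ d`.
[cite: NetzerPlaumannThom2013, §2 (Setup 2.4)] -/
theorem coeffSeq_eq_coeff [Nontrivial R] {d : ℕ} (a : Fin d → R) (k : ℕ) (hk : 0 < k) :
    coeffSeq a k = if k ≤ d then (X ^ d + ∑ i : Fin d, C (a i) * X ^ (i : ℕ)).coeff (d - k) else 0 := by
  unfold coeffSeq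
  by_cases hkd : k ≤ d
  · rw [dif_pos ⟨hk, hkd⟩, if_pos hkd, coeff_add, coeff_X_pow, if_neg (by omega), zero_add,
      finsetSum_coeff]
    simp only [coeff_C_mul, coeff_X_pow]
    rw [Finset.sum_eq_single (⟨d - k, by omega⟩ : Fin d)]
    · simp
    · intro i _ hi
      rw [if_neg, mul_zero]
      intro h
      exact hi (Fin.ext (by simp only at h ⊢; omega))
    · intro h; exact absurd (Finset.mem_univ _) h
  · rw [dif_neg (by omega), if_neg hkd]

/-- The companion matrix commutes with ring homomorphisms. [cite: NetzerPlaumannThom2013, §2 (Setup 2.4)] -/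
theorem map_companion {S : Type*} [CommRing S] (f : R →+* S) {d : ℕ} (a : Fin d → R) :
    (companion a).map f = companion (fun i => f (a i)) := by
  ext i j
  simp only [Matrix.map_apply, companion_apply]
  split_ifs <;> simp

/-- **The Vandermonde matrix intertwines the companion matrix with the diagonal matrix of the
roots**: if every `v_l` is a root of `t^d + Σ a_i t^i`, then `V 𝓛 = diag(v) V`, i.e. the rows
`(1, v_l, …, v_l^{d−1})` of `V` are left eigenvectors of `𝓛` («the eigenvalues of `𝓛_t(a)` are
precisely the zeros of `P(t,a)`»). [cite: NetzerPlaumannThom2013, Thm. 2.5 (proof)] -/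
theorem vandermonde_mul_companion {d : ℕ} (a : Fin d → R) (v : Fin d → R)
    (hv : ∀ l, (X ^ d + ∑ i : Fin d, C (a i) * X ^ (i : ℕ)).IsRoot (v l)) :
    Matrix.vandermonde v * companion a = diagonal v * Matrix.vandermonde v := by
  ext l j
  rw [Matrix.mul_apply, diagonal_mul, Matrix.vandermonde_apply]
  simp only [Matrix.vandermonde_apply, companion_apply]
  by_cases hj : (j : ℕ) + 1 = d
  · simp only [hj, if_true, mul_neg, Finset.sum_neg_distrib]
    have h := hv l
    rw [IsRoot.def, eval_add, eval_pow, eval_X, eval_finsetSum] at h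
    simp only [eval_mul, eval_C, eval_pow, eval_X] at h
    have h' : ∑ i : Fin d, v l ^ (i : ℕ) * a i = -(v l ^ d) := by
      rw [← sub_eq_zero, sub_neg_eq_add, add_comm, ← h]
      congr 1
      exact Finset.sum_congr rfl fun i _ => mul_comm _ _
    rw [h', neg_neg, ← pow_succ', hj]
  · simp only [hj, if_false]
    rw [Finset.sum_eq_single (⟨(j : ℕ) + 1, by omega⟩ : Fin d)]
    · simp [pow_succ, mul_comm]
    · intro i _ hi
      rw [if_neg, mul_zero]
      intro h
      exact hi (Fin.ext h)
    · intro h; exact absurd (Finset.mem_univ _) h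

/-- **Lemma 2.2 (algebraic core, any domain).** For the companion matrix `𝓛` of
`t^d + Σ a_i t^i` and the Hermite matrix `𝓗 = (N_{i+j})` built from the same coefficients,
`𝓛ᵀ 𝓗 = 𝓗 𝓛` («`𝓛_t` is self-adjoint with respect to `⟨f,g⟩_p = fᵀ q²𝓗(p) g`»).  Proof: over an
algebraic closure of the fraction field, `𝓗 = VᵀV` and `V𝓛 = diag(v)V` for the Vandermonde matrix
`V` of the roots, so both sides equal `Vᵀ diag(v) V`; the printed proof uses Newton's identity
instead. [cite: NetzerPlaumannThom2013, Lemma 2.2] -/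
theorem companion_transpose_mul_hermiteOfCoeff [IsDomain R] {d : ℕ} (a : Fin d → R) :
    (companion a)ᵀ * hermiteOfCoeff d (coeffSeq a) = hermiteOfCoeff d (coeffSeq a) * companion a := by
  -- pass to an algebraic closure of the fraction field
  let L := AlgebraicClosure (FractionRing R)
  let f : R →+* L := (algebraMap (FractionRing R) L).comp (algebraMap R (FractionRing R))
  have hf : Function.Injective f :=
    (algebraMap (FractionRing R) L).injective.comp (IsFractionRing.injective R (FractionRing R))
  have hinj : Function.Injective (fun M : Matrix (Fin d) (Fin d) R => M.map f) :=
    fun M N h => Matrix.ext fun i j => hf (congr_fun (congr_fun h i) j)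
  apply hinj
  simp only [Matrix.map_mul, transpose_map, map_hermiteOfCoeff, map_companion]
  simp only [map_coeffSeq]
  set b : Fin d → L := fun i => f (a i) with hb
  -- roots of the mapped polynomial
  set P : L[X] := X ^ d + ∑ i : Fin d, C (b i) * X ^ (i : ℕ) with hP
  have hmonic : P.Monic := Literature.LinearAlgebra.Matrix.monic_X_pow_add_sum b
  have hdeg : P.natDegree = d := Literature.LinearAlgebra.Matrix.natDegree_X_pow_add_sum b
  have hsplit : P.Splits := IsAlgClosed.splits P
  obtain ⟨l, hl⟩ : ∃ l : List L, (l : Multiset L) = P.roots := ⟨_, Multiset.coe_toList _⟩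
  have hlen : l.length = d := by
    rw [← Multiset.coe_card, hl, ← hdeg]; exact (hsplit.natDegree_eq_card_roots).symm
  -- enumerate the roots by `Fin d`
  obtain ⟨v, hv⟩ : ∃ v : Fin d → L, (univ : Finset (Fin d)).val.map v = P.roots := by
    subst hlen
    exact ⟨l.get, by rw [Fin.univ_val_map, List.ofFn_get, hl]⟩
  have hc : ∀ k, 0 < k → coeffSeq b k = (-1) ^ k * ((univ : Finset (Fin d)).val.map v).esymm k :=
    coeff_eq_esymm_of_roots_eq hmonic hsplit hdeg v hv _ (fun k hk => coeffSeq_eq_coeff b k hk)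
  have hroot : ∀ l, P.IsRoot (v l) := by
    intro l
    have hmem : v l ∈ P.roots := by
      rw [← hv]; exact Multiset.mem_map_of_mem _ (Finset.mem_univ_val l)
    exact (mem_roots hmonic.ne_zero).mp hmem
  rw [hermiteOfCoeff_eq_transpose_vandermonde_mul v _ hc, ← Matrix.mul_assoc, ← transpose_mul,
    vandermonde_mul_companion b v hroot, Matrix.mul_assoc, vandermonde_mul_companion b v hroot,
    transpose_mul, diagonal_transpose, Matrix.mul_assoc]

/-- **Thm. 1.1 over a domain (full-rank clause): if `t^d + Σ a_i t^i` is separable over an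
extension field, its Hermite matrix is nonsingular.** [cite: NetzerPlaumannThom2013, Thm. 1.1] -/
theorem det_hermiteOfCoeff_coeffSeq_ne_zero [IsDomain R] {d : ℕ} (a : Fin d → R)
    (hsep : ((X ^ d + ∑ i : Fin d, C (a i) * X ^ (i : ℕ)).map
      (algebraMap R (FractionRing R))).Separable) :
    (hermiteOfCoeff d (coeffSeq a)).det ≠ 0 := by
  let L := AlgebraicClosure (FractionRing R)
  let f : R →+* L := (algebraMap (FractionRing R) L).comp (algebraMap R (FractionRing R))
  have hf : Function.Injective f :=
    (algebraMap (FractionRing R) L).injective.comp (IsFractionRing.injective R (FractionRing R))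
  intro h0
  have h1 : (hermiteOfCoeff d (coeffSeq fun i => f (a i))).det = 0 := by
    rw [← map_zero f, ← h0, RingHom.map_det, RingHom.mapMatrix_apply, map_hermiteOfCoeff]
    simp only [map_coeffSeq]
  set b : Fin d → L := fun i => f (a i) with hb
  set P : L[X] := X ^ d + ∑ i : Fin d, C (b i) * X ^ (i : ℕ) with hP
  have hmonic : P.Monic := Literature.LinearAlgebra.Matrix.monic_X_pow_add_sum b
  have hdeg : P.natDegree = d := Literature.LinearAlgebra.Matrix.natDegree_X_pow_add_sum b
  have hsplit : P.Splits := IsAlgClosed.splits P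
  have hPmap : P = ((X ^ d + ∑ i : Fin d, C (a i) * X ^ (i : ℕ)).map
      (algebraMap R (FractionRing R))).map (algebraMap (FractionRing R) L) := by
    rw [Polynomial.map_map]
    simp [hP, hb, Polynomial.map_add, Polynomial.map_pow, Polynomial.map_sum, f]
  have hsepP : P.Separable := by rw [hPmap]; exact hsep.map
  obtain ⟨l, hl⟩ : ∃ l : List L, (l : Multiset L) = P.roots := ⟨_, Multiset.coe_toList _⟩
  have hlen : l.length = d := by
    rw [← Multiset.coe_card, hl, ← hdeg]; exact (hsplit.natDegree_eq_card_roots).symm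
  obtain ⟨v, hv⟩ : ∃ v : Fin d → L, (univ : Finset (Fin d)).val.map v = P.roots := by
    subst hlen
    exact ⟨l.get, by rw [Fin.univ_val_map, List.ofFn_get, hl]⟩
  have hc : ∀ k, 0 < k → coeffSeq b k = (-1) ^ k * ((univ : Finset (Fin d)).val.map v).esymm k :=
    coeff_eq_esymm_of_roots_eq hmonic hsplit hdeg v hv _ (fun k hk => coeffSeq_eq_coeff b k hk)
  have hinjv : Function.Injective v := by
    have hnd : P.roots.Nodup := nodup_roots hsepP
    rw [← hv, Fin.univ_val_map, Multiset.coe_nodup, List.nodup_ofFn] at hnd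
    exact hnd
  exact (det_hermiteOfCoeff_ne_zero_iff v _ hc).mpr hinjv h1

end CompanionAlgebra

/-! ## §2: the companion matrix `𝓛_t` of `P(x,t) = t^d p(x/t)` and Lemma 2.2 -/

section Setup

variable {R : Type*} [CommRing R] {ι : Type*}

/-- The coefficient vector of `P(x,t) = t^d + p_1 t^{d−1} + ⋯ + p_d` in the format of the tree's
`companion`: `a_i = p_{d−i}` (coefficient of `t^i`). [cite: NetzerPlaumannThom2013, §2 (eq. (3))] -/
def compCoeff (p : MvPolynomial ι R) (d : ℕ) : Fin d → MvPolynomial ι R :=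
  fun i => MvPolynomial.homogeneousComponent (d - i) p

/-- **`𝓛_t`**, multiplication by `t` on the free `R[x]`-module `A = R[x,t]/(P) ≅ ⊕_{i<d} R[x]·t^i`
in the basis `1, t, …, t^{d−1}`: the companion matrix of `P`,
`(f_1,…,f_d) ↦ (−p_d f_d, f_1 − p_{d−1} f_d, …, f_{d−1} − p_1 f_d)` (eq. (3) of the source; the
tree's `Literature.LinearAlgebra.Matrix.companion`). [cite: NetzerPlaumannThom2013, §2 (eq. (3))] -/
def compL (p : MvPolynomial ι R) (d : ℕ) : Matrix (Fin d) (Fin d) (MvPolynomial ι R) :=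
  companion (compCoeff p d)

/-- `𝓛_t` has `1` on the subdiagonal, `−p_{d−i}` in the last column, `0` elsewhere.
[cite: NetzerPlaumannThom2013, §2 (eq. (3))] -/
theorem compL_apply (p : MvPolynomial ι R) (d : ℕ) (i j : Fin d) :
    compL p d i j = if (j : ℕ) + 1 = d then -MvPolynomial.homogeneousComponent (d - i) p
      else if (i : ℕ) = j + 1 then 1 else 0 := rfl

/-- For `p(0) = 1`, the homogenisation is the monic polynomial of the coefficient vector
`compCoeff`: `P = t^d + Σ_{i<d} p_{d−i} t^i`. [cite: NetzerPlaumannThom2013, §2 (Setup 2.4)] -/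
theorem homogenization_eq_X_pow_add_sum (p : MvPolynomial ι R) (d : ℕ)
    (hp : MvPolynomial.constantCoeff p = 1) :
    homogenization p d = X ^ d + ∑ i : Fin d, Polynomial.C (compCoeff p d i) * X ^ (i : ℕ) := by
  rw [homogenization, Finset.sum_range_succ', MvPolynomial.homogeneousComponent_zero, Nat.sub_zero,
    add_comm]
  have h0 : MvPolynomial.coeff 0 p = 1 := hp
  rw [h0, MvPolynomial.C_1, map_one, one_mul]
  congr 1
  rw [show (∑ i : Fin d, Polynomial.C (compCoeff p d i) * X ^ (i : ℕ)) =
      ∑ i : Fin d, (fun n : ℕ => Polynomial.C (MvPolynomial.homogeneousComponent (d - n) p) * X ^ n) i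
      from rfl, Fin.sum_univ_eq_sum_range
      (fun n : ℕ => Polynomial.C (MvPolynomial.homogeneousComponent (d - n) p) * X ^ n) d,
      ← Finset.sum_range_reflect]
  refine Finset.sum_congr rfl fun i hi => ?_
  rw [Finset.mem_range] at hi
  rw [show d - 1 - i + 1 = d - i by omega, show d - (d - i) = i by omega]

/-- The coefficient sequences agree: `coeffSeq (compCoeff p d) k = p_k` for `k ≥ 1` when
`deg p ≤ d`. [cite: NetzerPlaumannThom2013, §2 (Setup 2.4)] -/
theorem coeffSeq_compCoeff (p : MvPolynomial ι R) {d : ℕ} (hd : p.totalDegree ≤ d) (k : ℕ)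
    (hk : 0 < k) : coeffSeq (compCoeff p d) k = MvPolynomial.homogeneousComponent k p := by
  unfold coeffSeq compCoeff
  split_ifs with h
  · have e : d - (d - k) = k := by omega
    exact congrArg (fun n => MvPolynomial.homogeneousComponent n p) (by simpa using e)
  · rw [MvPolynomial.homogeneousComponent_eq_zero]
    exact lt_of_le_of_lt hd (by omega)

/-- `𝓗(p)` is the Hermite matrix of the coefficient vector of `𝓛_t` (`deg p ≤ d`).
[cite: NetzerPlaumannThom2013, §2 (Setup 2.4)] -/
theorem paramHermite_eq_hermiteOfCoeff_coeffSeq (p : MvPolynomial ι R) {d : ℕ}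
    (hd : p.totalDegree ≤ d) : paramHermite p d = hermiteOfCoeff d (coeffSeq (compCoeff p d)) := by
  refine Matrix.ext fun i j => ?_
  rw [paramHermite_apply, hermiteOfCoeff_apply]
  exact newtonOfCoeff_congr (fun k hk => (coeffSeq_compCoeff p hd k hk).symm) _

/-- **NPT 2013, Lemma 2.2.** `𝓛_t` is self-adjoint for the Hankel form of `𝓗(p)`:
`𝓛_tᵀ 𝓗(p) = 𝓗(p) 𝓛_t` (over any integral domain of coefficients, `deg p ≤ d`).
[cite: NetzerPlaumannThom2013, Lemma 2.2] -/
theorem lemma_2_2 [IsDomain R] (p : MvPolynomial ι R) {d : ℕ} (hd : p.totalDegree ≤ d) :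
    (compL p d)ᵀ * paramHermite p d = paramHermite p d * compL p d := by
  rw [paramHermite_eq_hermiteOfCoeff_coeffSeq p hd, compL]
  exact companion_transpose_mul_hermiteOfCoeff _

/-- **Lemma 2.2 as printed**: with `⟨f, g⟩_p := fᵀ (q² 𝓗(p)) g` on `A = R[x]^d`,
`⟨𝓛_t f, g⟩_p = ⟨f, 𝓛_t g⟩_p` for all `f, g`. [cite: NetzerPlaumannThom2013, Lemma 2.2] -/
theorem lemma_2_2_bilin [IsDomain R] (p : MvPolynomial ι R) {d : ℕ} (hd : p.totalDegree ≤ d)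
    (q : MvPolynomial ι R) (f g : Fin d → MvPolynomial ι R) :
    (compL p d *ᵥ f) ⬝ᵥ ((q ^ 2 • paramHermite p d) *ᵥ g) =
      f ⬝ᵥ ((q ^ 2 • paramHermite p d) *ᵥ (compL p d *ᵥ g)) := by
  have h : (compL p d)ᵀ * (q ^ 2 • paramHermite p d) = (q ^ 2 • paramHermite p d) * compL p d := by
    rw [Matrix.mul_smul, Matrix.smul_mul, lemma_2_2 p hd]
  rw [show compL p d *ᵥ f = f ᵥ* (compL p d)ᵀ from (Matrix.vecMul_transpose _ _).symm,
    ← Matrix.dotProduct_mulVec, Matrix.mulVec_mulVec, Matrix.mulVec_mulVec, h]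

/-- The characteristic polynomial of `𝓛_t` is `P(x,t)` («It is well known and easy to see that `P` is
the characteristic polynomial of `𝓛_t`»; the tree's `charpoly_companion`, transported from the
fraction field). [cite: NetzerPlaumannThom2013, §2 (before eq. (4))] -/
theorem charpoly_compL [IsDomain R] (p : MvPolynomial ι R) (d : ℕ)
    (hp : MvPolynomial.constantCoeff p = 1) : (compL p d).charpoly = homogenization p d := by
  let K := FractionRing (MvPolynomial ι R)
  apply Polynomial.map_injective (algebraMap (MvPolynomial ι R) K) (IsFractionRing.injective _ _)
  rw [← Matrix.charpoly_map, compL, map_companion, charpoly_companion,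
    homogenization_eq_X_pow_add_sum p d hp, Polynomial.map_add, Polynomial.map_pow, Polynomial.map_X,
    Polynomial.map_sum]
  simp only [Polynomial.map_mul, Polynomial.map_pow, Polynomial.map_X, Polynomial.map_C]

/-- Summing the homogeneous parts up to any `d ≥ deg p` gives back `p`. [folklore] -/
private theorem sum_homogeneousComponent_of_le (p : MvPolynomial ι R) {d : ℕ} (hd : p.totalDegree ≤ d) :
    ∑ i ∈ range (d + 1), MvPolynomial.homogeneousComponent i p = p := by
  conv_rhs => rw [← MvPolynomial.sum_homogeneousComponent p]
  symm
  refine Finset.sum_subset (Finset.range_subset_range.mpr (by omega)) fun i hi hi' => ?_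
  rw [Finset.mem_range] at hi hi'
  exact MvPolynomial.homogeneousComponent_eq_zero _ _ (by omega)

/-- **Eq. (4): `det(I − 𝓛_t) = p`.** [cite: NetzerPlaumannThom2013, §2 (eq. (4))] -/
theorem det_one_sub_compL [IsDomain R] (p : MvPolynomial ι R) {d : ℕ}
    (hp : MvPolynomial.constantCoeff p = 1) (hd : p.totalDegree ≤ d) :
    (1 - compL p d).det = p := by
  have h := Matrix.eval_charpoly (compL p d) 1
  rw [map_one, charpoly_compL p d hp, homogenization, eval_finsetSum] at h
  simp only [eval_mul, eval_C, eval_pow, eval_X, one_pow, mul_one] at h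
  rw [sum_homogeneousComponent_of_le p hd] at h
  exact h.symm

/-- **Thm. 1.1 / Lemma 2.3 (1), the algebraic input: `𝓗(p)` is nonsingular over `R[x]` when
`P(x,t)` is separable over the function field `R(x)`** (e.g. `p` square-free, see
`separable_homogenization_of_squarefree`). [cite: NetzerPlaumannThom2013, Lemma 2.3 (1) (proof)] -/
theorem det_paramHermite_ne_zero [IsDomain R] (p : MvPolynomial ι R) {d : ℕ}
    (hp : MvPolynomial.constantCoeff p = 1) (hd : p.totalDegree ≤ d)
    (hsep : ((homogenization p d).map
      (algebraMap (MvPolynomial ι R) (FractionRing (MvPolynomial ι R)))).Separable) :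
    (paramHermite p d).det ≠ 0 := by
  rw [paramHermite_eq_hermiteOfCoeff_coeffSeq p hd]
  refine det_hermiteOfCoeff_coeffSeq_ne_zero (compCoeff p d) ?_
  rwa [← homogenization_eq_X_pow_add_sum p d hp]

end Setup


/-! ## Square-free `p` ⇒ `P(x,t)` separable over `ℝ(x)` (the use of «`p` square-free» in Lemma 2.3 / Thm. 2.5) -/

section Squarefree

variable {F : Type*} [Field F] {ι : Type*}

/-- Squarefreeness is invariant under ring isomorphisms. [folklore] -/
private theorem squarefree_of_ringEquiv {A B : Type*} [CommRing A] [CommRing B] (e : A ≃+* B) {x : A}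
    (hx : Squarefree x) : Squarefree (e x) := by
  intro b hb
  have h : e.symm b * e.symm b ∣ x := by
    have := map_dvd e.symm hb
    rwa [map_mul, RingEquiv.symm_apply_apply] at this
  have hu := (hx _ h).map e
  rwa [RingEquiv.apply_symm_apply] at hu

/-- The dehomogenisation `t ↦ 1` on `F[x, t]` (`t = X none`). [cite: NetzerPlaumannThom2013, §2 (Setup 2.4: `A = R[x,t]/(P)`)] -/
def dehomog (F : Type*) [Field F] (ι : Type*) : MvPolynomial (Option ι) F →ₐ[F] MvPolynomial ι F :=
  MvPolynomial.aeval fun o => o.elim 1 MvPolynomial.X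

/-- `dehomog` is a left inverse of the inclusion `F[x] → F[x,t]` (`x_i ↦ x_i`).
[cite: NetzerPlaumannThom2013, §2 (Setup 2.4)] -/
theorem dehomog_rename_some (q : MvPolynomial ι F) : dehomog F ι (MvPolynomial.rename some q) = q := by
  rw [dehomog, MvPolynomial.aeval_rename]
  conv_rhs => rw [← MvPolynomial.aeval_X_left_apply (R := F) q]
  rfl

/-- `dehomog` does not increase the total degree. [cite: NetzerPlaumannThom2013, §2 (Setup 2.4)] -/
theorem totalDegree_dehomog_le (A : MvPolynomial (Option ι) F) :
    (dehomog F ι A).totalDegree ≤ A.totalDegree := by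
  classical
  conv_lhs => rw [← MvPolynomial.support_sum_monomial_coeff A, map_sum]
  refine (MvPolynomial.totalDegree_finsetSum _ _).trans (Finset.sup_le fun m hm => ?_)
  rw [dehomog, MvPolynomial.aeval_monomial, MvPolynomial.algebraMap_eq]
  refine (MvPolynomial.totalDegree_mul _ _).trans ?_
  rw [MvPolynomial.totalDegree_C, zero_add, Finsupp.prod]
  refine (MvPolynomial.totalDegree_finsetProd _ _).trans ?_
  have h1 : ∀ o : Option ι, (Option.elim o (1 : MvPolynomial ι F) MvPolynomial.X).totalDegree ≤ 1 := by
    intro o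
    cases o with
    | none => simp
    | some i => exact (MvPolynomial.totalDegree_X (R := F) i).le
  refine (Finset.sum_le_sum fun o _ => (MvPolynomial.totalDegree_pow _ _).trans
    (Nat.mul_le_mul_left (m o) (h1 o))).trans ?_
  simp only [mul_one]
  exact MvPolynomial.le_totalDegree hm

/-- The homogenisation as a genuine `(n+1)`-variate polynomial `P̃ ∈ F[x, t]`.
[cite: NetzerPlaumannThom2013, §2 (Setup 2.4)] -/
def homogenizationOpt (p : MvPolynomial ι F) (d : ℕ) : MvPolynomial (Option ι) F :=
  ∑ i ∈ range (d + 1), MvPolynomial.rename some (MvPolynomial.homogeneousComponent i p) *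
    MvPolynomial.X none ^ (d - i)

/-- `P̃` corresponds to `P ∈ F[x][t]` under `F[x,t] ≅ F[x][t]` (Mathlib's `optionEquivLeft`).
[cite: NetzerPlaumannThom2013, §2 (Setup 2.4)] -/
theorem optionEquivLeft_homogenizationOpt (p : MvPolynomial ι F) (d : ℕ) :
    MvPolynomial.optionEquivLeft F ι (homogenizationOpt p d) = homogenization p d := by
  have hC : ∀ q : MvPolynomial ι F, MvPolynomial.optionEquivLeft F ι (MvPolynomial.rename some q) =
      Polynomial.C q := by
    intro q
    have h : ((MvPolynomial.optionEquivLeft F ι).toAlgHom.comp (MvPolynomial.rename some)) =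
        (Polynomial.CAlgHom : MvPolynomial ι F →ₐ[F] Polynomial (MvPolynomial ι F)).comp
          (MvPolynomial.aeval MvPolynomial.X) := by
      refine MvPolynomial.algHom_ext fun i => ?_
      simp [MvPolynomial.optionEquivLeft_X_some]
    have h' := congr_arg (fun φ => φ q) h
    simpa using h'
  rw [homogenizationOpt, homogenization, map_sum]
  refine Finset.sum_congr rfl fun i _ => ?_
  rw [map_mul, map_pow, hC, MvPolynomial.optionEquivLeft_X_none]

/-- `P̃(x, 1) = p` (`deg p ≤ d`). [cite: NetzerPlaumannThom2013, §2 (Setup 2.4)] -/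
theorem dehomog_homogenizationOpt (p : MvPolynomial ι F) {d : ℕ} (hd : p.totalDegree ≤ d) :
    dehomog F ι (homogenizationOpt p d) = p := by
  rw [homogenizationOpt, map_sum]
  simp only [map_mul, map_pow, dehomog_rename_some]
  have h1 : dehomog F ι (MvPolynomial.X none) = 1 := by simp [dehomog]
  simp only [h1, one_pow, mul_one]
  exact sum_homogeneousComponent_of_le p hd

/-- `deg P̃ ≤ d`. [cite: NetzerPlaumannThom2013, §2 (Setup 2.4)] -/
theorem totalDegree_homogenizationOpt_le (p : MvPolynomial ι F) (d : ℕ) :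
    (homogenizationOpt p d).totalDegree ≤ d := by
  rw [homogenizationOpt]
  refine (MvPolynomial.totalDegree_finsetSum _ _).trans (Finset.sup_le fun i hi => ?_)
  rw [Finset.mem_range] at hi
  refine (MvPolynomial.totalDegree_mul _ _).trans ?_
  refine (add_le_add ((MvPolynomial.totalDegree_rename_le _ _).trans
    (MvPolynomial.homogeneousComponent_isHomogeneous i p).totalDegree_le)
    ((MvPolynomial.totalDegree_pow _ _).trans (Nat.mul_le_mul_left _
      (MvPolynomial.totalDegree_X (R := F) (none : Option ι)).le))).trans ?_
  omega

/-- **The homogenisation of a square-free polynomial is square-free** (degrees: if `A² B = P̃`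
then `A(x,1)` is a unit, so `d = deg p ≤ deg B ≤ d − 2 deg A`). [cite: NetzerPlaumannThom2013, Lemma 2.3 (1) («If `p` is square-free»)] -/
theorem squarefree_homogenizationOpt (p : MvPolynomial ι F) {d : ℕ} (hdeg : p.totalDegree = d)
    (hsq : Squarefree p) : Squarefree (homogenizationOpt p d) := by
  intro A hA
  obtain ⟨B, hB⟩ := hA
  have hP0 : homogenizationOpt p d ≠ 0 := by
    intro h
    have := dehomog_homogenizationOpt p hdeg.le
    rw [h, map_zero] at this
    exact hsq.ne_zero this.symm
  have hA0 : A ≠ 0 := by rintro rfl; exact hP0 (by rw [hB, zero_mul, zero_mul])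
  have hB0 : B ≠ 0 := by rintro rfl; exact hP0 (by rw [hB, mul_zero])
  -- degrees in `F[x,t]`
  have hdegs : A.totalDegree + A.totalDegree + B.totalDegree ≤ d := by
    have h := totalDegree_homogenizationOpt_le p d
    rwa [hB, MvPolynomial.totalDegree_mul_of_isDomain (mul_ne_zero hA0 hA0) hB0,
      MvPolynomial.totalDegree_mul_of_isDomain hA0 hA0] at h
  -- dehomogenise
  have hδ : dehomog F ι A * dehomog F ι A * dehomog F ι B = p := by
    rw [← map_mul, ← map_mul, ← hB, dehomog_homogenizationOpt p hdeg.le]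
  have hunit : IsUnit (dehomog F ι A) := hsq _ (Dvd.intro _ hδ)
  obtain ⟨c, hc, hcA⟩ := (MvPolynomial.isUnit_iff_eq_C_of_isReduced).mp hunit
  have hdegp : p.totalDegree ≤ B.totalDegree := by
    rw [← hδ, hcA, ← map_mul]
    refine (MvPolynomial.totalDegree_mul _ _).trans ?_
    rw [MvPolynomial.totalDegree_C, zero_add]
    exact totalDegree_dehomog_le B
  have hA : A.totalDegree = 0 := by omega
  obtain ⟨a, rfl⟩ : ∃ a, A = MvPolynomial.C a :=
    ⟨_, (MvPolynomial.totalDegree_eq_zero_iff_eq_C).mp hA⟩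
  have ha : a ≠ 0 := fun h => hA0 (by rw [h, map_zero])
  exact (Ne.isUnit ha).map MvPolynomial.C

/-- Hence `P ∈ F[x][t]` is square-free for square-free `p` of degree `d`.
[cite: NetzerPlaumannThom2013, Lemma 2.3 (1)] -/
theorem squarefree_homogenization (p : MvPolynomial ι F) {d : ℕ} (hdeg : p.totalDegree = d)
    (hsq : Squarefree p) : Squarefree (homogenization p d) := by
  rw [← optionEquivLeft_homogenizationOpt]
  exact squarefree_of_ringEquiv (MvPolynomial.optionEquivLeft F ι).toRingEquiv
    (squarefree_homogenizationOpt p hdeg hsq)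

/-- **Gauss's lemma for square-freeness**: a monic square-free polynomial over an integrally closed
domain stays square-free over the fraction field (the step taking «`p` square-free» of Lemma 2.3 (1)
to separability of `P` over `ℝ(x)`). [cite: NetzerPlaumannThom2013, Lemma 2.3 (1) (proof)] -/
theorem squarefree_map_of_monic {R : Type*} [CommRing R] [IsDomain R] [IsIntegrallyClosed R]
    (K : Type*) [Field K] [Algebra R K] [IsFractionRing R K] {f : R[X]} (hf : f.Monic)
    (hsq : Squarefree f) : Squarefree (f.map (algebraMap R K)) := by
  intro g hg
  have hfK : (f.map (algebraMap R K)).Monic := hf.map _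
  have hg0 : g ≠ 0 := by
    rintro rfl
    obtain ⟨c, hc⟩ := hg
    exact hfK.ne_zero (by rw [hc, zero_mul, zero_mul])
  -- normalise `g` to be monic
  set u : K[X] := C (g.leadingCoeff)⁻¹ with hu
  have hu1 : IsUnit u := isUnit_C.mpr (Ne.isUnit (inv_ne_zero (leadingCoeff_ne_zero.mpr hg0)))
  set g₁ : K[X] := g * u with hg₁
  have hg₁m : g₁.Monic := by
    rw [hg₁, hu]
    exact monic_mul_leadingCoeff_inv hg0
  have hgg : g₁ * g₁ ∣ f.map (algebraMap R K) := by
    rw [hg₁, mul_mul_mul_comm, IsUnit.mul_right_dvd (hu1.mul hu1)]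
    exact hg
  obtain ⟨h, hh⟩ := hgg
  have hhm : h.Monic := Monic.of_mul_monic_left (hg₁m.mul hg₁m) (by rw [← hh]; exact hfK)
  obtain ⟨a, ha⟩ := IsIntegrallyClosed.eq_map_mul_C_of_dvd K hf
    (show g₁ ∣ f.map (algebraMap R K) from ⟨g₁ * h, by rw [hh, mul_assoc]⟩)
  obtain ⟨b, hb⟩ := IsIntegrallyClosed.eq_map_mul_C_of_dvd K hf
    (show h ∣ f.map (algebraMap R K) from ⟨g₁ * g₁, by rw [hh, mul_comm]⟩)
  rw [hg₁m.leadingCoeff, map_one, mul_one] at ha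
  rw [hhm.leadingCoeff, map_one, mul_one] at hb
  have hf' : f = a * a * b := by
    apply Polynomial.map_injective (algebraMap R K) (IsFractionRing.injective R K)
    rw [Polynomial.map_mul, Polynomial.map_mul, ha, hb, hh]
  have hau : IsUnit a := hsq a ⟨b, hf'⟩
  have hg₁u : IsUnit g₁ := by
    rw [← ha]; exact hau.map (Polynomial.mapRingHom (algebraMap R K))
  rw [hg₁] at hg₁u
  exact (IsUnit.mul_iff.mp hg₁u).1

/-- **Square-free `p` ⇒ `P(x,t)` separable over `F(x)`** (char `0`): the form in which «`p`
square-free» enters Lemma 2.3 and Thm. 2.5. [cite: NetzerPlaumannThom2013, Lemma 2.3 (1)] -/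
theorem separable_homogenization_of_squarefree [CharZero F] (p : MvPolynomial ι F) {d : ℕ}
    (hp : MvPolynomial.constantCoeff p = 1) (hdeg : p.totalDegree = d) (hsq : Squarefree p) :
    ((homogenization p d).map (algebraMap (MvPolynomial ι F) (FractionRing (MvPolynomial ι F)))).Separable := by
  rw [PerfectField.separable_iff_squarefree]
  exact squarefree_map_of_monic _ (monic_homogenization p d hp) (squarefree_homogenization p hdeg hsq)

end Squarefree

/-! ## Lemma 2.3 and Theorem 2.5 -/

section Thm25

variable {F : Type*} [Field F] {ι : Type*}

/-- `P(x,1) = p` (`deg p ≤ d`). [cite: NetzerPlaumannThom2013, §2 (eq. (4))] -/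
theorem eval_one_homogenization (p : MvPolynomial ι F) {d : ℕ} (hd : p.totalDegree ≤ d) :
    (homogenization p d).eval 1 = p := by
  rw [homogenization, eval_finsetSum]
  simp only [eval_mul, eval_C, eval_pow, eval_X, one_pow, mul_one]
  exact sum_homogeneousComponent_of_le p hd

/-- **NPT 2013, Lemma 2.3 (2).** With `q²𝓗(p) = 𝒬ᵀ𝒬`, the map `𝒬 : A = R^d → B = R^k` is an
isometry from `⟨f,g⟩_p = fᵀ q²𝓗(p) g` to the standard form: `⟨f,g⟩_p = ⟨𝒬f, 𝒬g⟩`.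
[cite: NetzerPlaumannThom2013, Lemma 2.3 (2)] -/
theorem lemma_2_3_2 {R : Type*} [CommRing R] {d k : ℕ} (H : Matrix (Fin d) (Fin d) R) (q : R)
    (Q : Matrix (Fin k) (Fin d) R) (hQ : Qᵀ * Q = q ^ 2 • H) (f g : Fin d → R) :
    f ⬝ᵥ ((q ^ 2 • H) *ᵥ g) = (Q *ᵥ f) ⬝ᵥ (Q *ᵥ g) := by
  rw [← hQ, ← Matrix.mulVec_mulVec, Matrix.dotProduct_mulVec,
    show f ᵥ* Qᵀ = Q *ᵥ f from Matrix.vecMul_transpose _ _]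

/-- **NPT 2013, Lemma 2.3 (1).** If `p` is square-free of degree `d` with `p(0) = 1`, `q ≠ 0` and
`q²𝓗(p) = 𝒬ᵀ𝒬`, then `𝒬 : R^d → R^k` is injective (`R = F[x]`, `char F = 0`).  Printed proof:
positive definiteness of `𝓗(p)(a)` at generic `a`; here: `𝓗(p)` is nonsingular because `P(x,t)` is
separable over `F(x)`. [cite: NetzerPlaumannThom2013, Lemma 2.3 (1)] -/
theorem lemma_2_3_1 [CharZero F] (p : MvPolynomial ι F) {d : ℕ}
    (hp : MvPolynomial.constantCoeff p = 1) (hdeg : p.totalDegree = d) (hsq : Squarefree p)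
    {q : MvPolynomial ι F} (hq : q ≠ 0) {k : ℕ} (Q : Matrix (Fin k) (Fin d) (MvPolynomial ι F))
    (hQ : Qᵀ * Q = q ^ 2 • paramHermite p d) :
    Function.Injective Q.mulVec := by
  have hdet := det_paramHermite_ne_zero p hp hdeg.le (separable_homogenization_of_squarefree p hp hdeg hsq)
  have hker : ∀ f : Fin d → MvPolynomial ι F, Q *ᵥ f = 0 → f = 0 := by
    intro f hf
    have h1 : (q ^ 2 • paramHermite p d) *ᵥ f = 0 := by
      rw [← hQ, ← Matrix.mulVec_mulVec, hf, Matrix.mulVec_zero]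
    rw [Matrix.smul_mulVec, smul_eq_zero] at h1
    rcases h1 with h1 | h1
    · exact absurd h1 (pow_ne_zero 2 hq)
    · exact Matrix.eq_zero_of_mulVec_eq_zero hdet h1
  intro f g hfg
  rw [← sub_eq_zero]
  refine hker _ ?_
  rw [Matrix.mulVec_sub, sub_eq_zero]
  exact hfg

/-- **NPT 2013, Theorem 2.5 (main result), for an arbitrary matrix `𝓜` over `F[x]`.**  Let `p` be
square-free of degree `d` with `p(0) = 1`, let `q ≠ 0` and `q²𝓗(p) = 𝒬ᵀ𝒬` with
`𝒬 ∈ Mat_{k×d}(F[x])` (Setup 2.4), and let `𝓜 ∈ Mat_k(F[x])` make the diagram commute: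
`𝓜𝒬 = 𝒬𝓛_t`.  Then `p` divides `det(I − 𝓜)`.  Proof (algebraic, replacing the printed
generic-point + real-Nullstellensatz argument): over an algebraic closure `L` of `F(x)`, `P` has
`d` distinct roots `μ_l`; the columns of `𝒬V⁻¹` (`V` the Vandermonde matrix, `V𝓛_t = diag(μ)V`)
are eigenvectors of `𝓜` for the `μ_l` (`𝒬` is injective by Lemma 2.3), so `P ∣ χ_𝓜` in `L[t]`,
hence in `F[x][t]` (`P` monic), and `t ↦ 1` gives `p = P(x,1) ∣ χ_𝓜(1) = det(I − 𝓜)`.  The printed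
hypotheses «`p` real-zero», «`𝓜` homogeneous symmetric linear» are not needed for the conclusion.
[cite: NetzerPlaumannThom2013, Thm. 2.5] -/
theorem thm_2_5_matrix [CharZero F] (p : MvPolynomial ι F) {d : ℕ}
    (hp : MvPolynomial.constantCoeff p = 1) (hdeg : p.totalDegree = d) (hsq : Squarefree p)
    {q : MvPolynomial ι F} (hq : q ≠ 0) {k : ℕ} (Q : Matrix (Fin k) (Fin d) (MvPolynomial ι F))
    (hQ : Qᵀ * Q = q ^ 2 • paramHermite p d) (M : Matrix (Fin k) (Fin k) (MvPolynomial ι F))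
    (hcomm : M * Q = Q * compL p d) :
    p ∣ (1 - M).det := by
  classical
  -- Notation and the passage to an algebraic closure `L` of the function field
  let K := FractionRing (MvPolynomial ι F)
  let L := AlgebraicClosure K
  let f : MvPolynomial ι F →+* L := (algebraMap K L).comp (algebraMap (MvPolynomial ι F) K)
  have hf : Function.Injective f :=
    (algebraMap K L).injective.comp (IsFractionRing.injective (MvPolynomial ι F) K)
  -- `P`, its image in `L[t]` and its (simple) roots
  have hPeq := homogenization_eq_X_pow_add_sum p d hp
  set a : Fin d → MvPolynomial ι F := compCoeff p d with ha
  set b : Fin d → L := fun i => f (a i) with hb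
  set PL : L[X] := X ^ d + ∑ i : Fin d, C (b i) * X ^ (i : ℕ) with hPL
  have hPLmap : (homogenization p d).map f = PL := by
    rw [hPeq, Polynomial.map_add, Polynomial.map_pow, Polynomial.map_X, Polynomial.map_sum]
    simp only [Polynomial.map_mul, Polynomial.map_pow, Polynomial.map_X, Polynomial.map_C]
    rfl
  have hmonic : PL.Monic := Literature.LinearAlgebra.Matrix.monic_X_pow_add_sum b
  have hdegPL : PL.natDegree = d := Literature.LinearAlgebra.Matrix.natDegree_X_pow_add_sum b
  have hsplit : PL.Splits := IsAlgClosed.splits PL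
  have hsep : PL.Separable := by
    rw [← hPLmap, show f = (algebraMap K L).comp (algebraMap (MvPolynomial ι F) K) from rfl,
      ← Polynomial.map_map]
    exact (separable_homogenization_of_squarefree p hp hdeg hsq).map
  obtain ⟨lst, hl⟩ : ∃ l : List L, (l : Multiset L) = PL.roots := ⟨_, Multiset.coe_toList _⟩
  have hlen : lst.length = d := by
    rw [← Multiset.coe_card, hl, ← hdegPL]; exact (hsplit.natDegree_eq_card_roots).symm
  obtain ⟨v, hv⟩ : ∃ v : Fin d → L, (univ : Finset (Fin d)).val.map v = PL.roots := by
    subst hlen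
    exact ⟨lst.get, by rw [Fin.univ_val_map, List.ofFn_get, hl]⟩
  have hroot : ∀ l, PL.IsRoot (v l) := by
    intro l
    have hmem : v l ∈ PL.roots := by
      rw [← hv]; exact Multiset.mem_map_of_mem _ (Finset.mem_univ_val l)
    exact (mem_roots hmonic.ne_zero).mp hmem
  have hinjv : Function.Injective v := by
    have hnd : PL.roots.Nodup := nodup_roots hsep
    rw [← hv, Fin.univ_val_map, Multiset.coe_nodup, List.nodup_ofFn] at hnd
    exact hnd
  -- the Vandermonde matrix of the roots intertwines `𝓛_t` and `diag(μ)`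
  set V : Matrix (Fin d) (Fin d) L := Matrix.vandermonde v with hVdef
  have hVL : V * (compL p d).map f = diagonal v * V := by
    rw [compL, map_companion]
    exact vandermonde_mul_companion b v hroot
  have hVdet : IsUnit V.det :=
    (Ne.isUnit (Matrix.det_vandermonde_ne_zero_iff.mpr hinjv))
  have hLV : (compL p d).map f * V⁻¹ = V⁻¹ * diagonal v := by
    calc (compL p d).map f * V⁻¹ = V⁻¹ * (V * (compL p d).map f) * V⁻¹ := by
          rw [← Matrix.mul_assoc, Matrix.nonsing_inv_mul _ hVdet, Matrix.one_mul]
      _ = V⁻¹ * diagonal v := by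
          rw [hVL, Matrix.mul_assoc, Matrix.mul_assoc, Matrix.mul_nonsing_inv _ hVdet, Matrix.mul_one]
  -- `𝒬` stays injective over `L`
  have hdetH : ((paramHermite p d).map f).det ≠ 0 := by
    rw [← RingHom.mapMatrix_apply, ← RingHom.map_det]
    exact (map_ne_zero_iff f hf).mpr
      (det_paramHermite_ne_zero p hp hdeg.le (separable_homogenization_of_squarefree p hp hdeg hsq))
  have hQL : (Q.map f)ᵀ * Q.map f = f (q ^ 2) • (paramHermite p d).map f := by
    rw [← Matrix.transpose_map, ← Matrix.map_mul, hQ]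
    ext i j
    simp [Matrix.map_apply, Matrix.smul_apply]
  have hQinj : ∀ y : Fin d → L, Q.map f *ᵥ y = 0 → y = 0 := by
    intro y hy
    have h1 : ((Q.map f)ᵀ * Q.map f) *ᵥ y = 0 := by
      rw [← Matrix.mulVec_mulVec, hy, Matrix.mulVec_zero]
    rw [hQL, Matrix.smul_mulVec, smul_eq_zero] at h1
    rcases h1 with h1 | h1
    · exact absurd h1 ((map_ne_zero_iff f hf).mpr (pow_ne_zero 2 hq))
    · exact Matrix.eq_zero_of_mulVec_eq_zero hdetH h1
  -- eigenvectors of `𝓜`: the columns of `Y = 𝒬 V⁻¹`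
  set Y : Matrix (Fin k) (Fin d) L := Q.map f * V⁻¹ with hYdef
  have hMY : M.map f * Y = Y * diagonal v := by
    rw [hYdef, ← Matrix.mul_assoc, ← Matrix.map_mul, hcomm, Matrix.map_mul, Matrix.mul_assoc, hLV,
      Matrix.mul_assoc]
  have hcol : ∀ l : Fin d, (M.map f).charpoly.IsRoot (v l) := by
    intro l
    set y : Fin k → L := Y *ᵥ Pi.single l 1 with hydef
    have hy0 : y ≠ 0 := by
      intro hy
      have h2 : V⁻¹ *ᵥ Pi.single l 1 = 0 := by
        apply hQinj
        rw [Matrix.mulVec_mulVec, ← hYdef]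
        exact hy
      have h3 : (Pi.single l 1 : Fin d → L) = 0 := by
        have := congr_arg (V.mulVec) h2
        rwa [Matrix.mulVec_mulVec, Matrix.mul_nonsing_inv _ hVdet, Matrix.one_mulVec,
          Matrix.mulVec_zero] at this
      exact (one_ne_zero (α := L)) (by simpa using congr_fun h3 l)
    have heig : M.map f *ᵥ y = v l • y := by
      rw [hydef, Matrix.mulVec_mulVec, hMY, ← Matrix.mulVec_mulVec, Matrix.mulVec_single_one,
        ← Matrix.mulVec_smul]
      congr 1
      ext i
      by_cases h : i = l
      · subst h; simp
      · simp [h]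
    rw [IsRoot.def, Matrix.eval_charpoly, ← Matrix.exists_mulVec_eq_zero_iff]
    refine ⟨y, hy0, ?_⟩
    rw [Matrix.sub_mulVec, heig, sub_eq_zero]
    ext i
    simp [Matrix.scalar_apply, Matrix.mulVec, diagonal_dotProduct]
  -- `P ∣ χ_𝓜` over `L`, then over `R`, then at `t = 1`
  have hdvdL : PL ∣ (M.map f).charpoly := by
    have hPLprod : PL = ∏ l : Fin d, (X - C (v l)) := by
      have h := hsplit.eq_prod_roots
      rw [hmonic.leadingCoeff, map_one, one_mul, ← hv, Multiset.map_map] at h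
      rw [h, Finset.prod_eq_multiset_prod]
      rfl
    rw [hPLprod]
    exact Finset.prod_dvd_of_coprime ((pairwise_coprime_X_sub_C hinjv).set_pairwise _)
      fun l _ => dvd_iff_isRoot.mpr (hcol l)
  have hdvdR : homogenization p d ∣ M.charpoly := by
    rw [← Polynomial.map_dvd_map f hf (monic_homogenization p d hp), hPLmap, ← Matrix.charpoly_map]
    exact hdvdL
  have h1 := map_dvd (Polynomial.evalRingHom (1 : MvPolynomial ι F)) hdvdR
  simp only [Polynomial.coe_evalRingHom] at h1
  rw [eval_one_homogenization p hdeg.le, Matrix.eval_charpoly, map_one] at h1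
  exact h1

/-- **NPT 2013, Theorem 2.5 (as printed: a homogeneous linear matrix polynomial `𝓜`).**  Let `p`
be square-free of degree `d` with `p(0) = 1` (`char F = 0`; printed over `ℝ` for real-zero `p`),
`q ≠ 0`, `q²𝓗(p) = 𝒬ᵀ𝒬`, and let `𝓜 = x_1M_1 + ⋯ + x_nM_n` (`M_i ∈ Mat_k(F)`) make the diagram
`𝓜𝒬 = 𝒬𝓛_t` commute.  Then `p ∣ det(I − 𝓜)`.  (Symmetry of the `M_i`, needed in the source to
call `det(I − 𝓜)` a *definite determinantal representation* of a multiple of `p`, plays no role in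
the divisibility.) [cite: NetzerPlaumannThom2013, Thm. 2.5] -/
theorem thm_2_5 [CharZero F] [Fintype ι] (p : MvPolynomial ι F) {d : ℕ}
    (hp : MvPolynomial.constantCoeff p = 1) (hdeg : p.totalDegree = d) (hsq : Squarefree p)
    {q : MvPolynomial ι F} (hq : q ≠ 0) {k : ℕ} (Q : Matrix (Fin k) (Fin d) (MvPolynomial ι F))
    (hQ : Qᵀ * Q = q ^ 2 • paramHermite p d) (M : ι → Matrix (Fin k) (Fin k) F)
    (hcomm : (∑ i, (MvPolynomial.X i : MvPolynomial ι F) • (M i).map MvPolynomial.C) * Q =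
      Q * compL p d) :
    p ∣ (1 - ∑ i, (MvPolynomial.X i : MvPolynomial ι F) • (M i).map MvPolynomial.C).det :=
  thm_2_5_matrix p hp hdeg hsq hq Q hQ _ hcomm

/-- **Theorem 2.5 in the tree's normalisation** (`F = ℝ`): with `𝓜 = linPencil A = −Σ xᵢAᵢ`,
`det(I − 𝓜) = monicPencilDet A = det(I + Σ xᵢAᵢ)`, so `p ∣ monicPencilDet A`.
[cite: NetzerPlaumannThom2013, Thm. 2.5] -/
theorem thm_2_5_monicPencilDet {ι : Type*} [Fintype ι] (p : MvPolynomial ι ℝ) {d : ℕ}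
    (hp : MvPolynomial.constantCoeff p = 1) (hdeg : p.totalDegree = d) (hsq : Squarefree p)
    {q : MvPolynomial ι ℝ} (hq : q ≠ 0) {k : ℕ} (Q : Matrix (Fin k) (Fin d) (MvPolynomial ι ℝ))
    (hQ : Qᵀ * Q = q ^ 2 • paramHermite p d) (A : ι → Matrix (Fin k) (Fin k) ℝ)
    (hcomm : linPencil A * Q = Q * compL p d) :
    p ∣ monicPencilDet A := by
  rw [← det_one_sub_linPencil]
  exact thm_2_5_matrix p hp hdeg hsq hq Q hQ _ hcomm

end Thm25

/-! ## §3: rational representations of degree one (Theorem 3.1) -/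

section Thm31

variable {F : Type*} [Field F] {ι : Type*}

/-- The matrix `𝓜 := q⁻² 𝒬 𝓛_t 𝓗(p)⁻¹ 𝒬ᵀ` of Theorem 3.1, over the function field `K = F(x)`
(`φ : F[x] → K` the inclusion). [cite: NetzerPlaumannThom2013, Thm. 3.1] -/
def ratRep (K : Type*) [Field K] [Algebra (MvPolynomial ι F) K] (p : MvPolynomial ι F) (d : ℕ)
    (q : MvPolynomial ι F) {k : ℕ} (Q : Matrix (Fin k) (Fin d) (MvPolynomial ι F)) :
    Matrix (Fin k) (Fin k) K :=
  (algebraMap (MvPolynomial ι F) K (q ^ 2))⁻¹ •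
    (Q.map (algebraMap _ K) * (compL p d).map (algebraMap _ K) *
      ((paramHermite p d).map (algebraMap _ K))⁻¹ * (Q.map (algebraMap _ K))ᵀ)

/-- **NPT 2013, Theorem 3.1 (determinant).** For `p` square-free of degree `d` with `p(0) = 1`
(`char F = 0`), `q ≠ 0` and `q²𝓗(p) = 𝒬ᵀ𝒬`: the matrix `𝓜 = q⁻²𝒬𝓛_t𝓗⁻¹𝒬ᵀ` over `K = F(x)`
satisfies `det(I − 𝓜) = p` (Sylvester's determinant theorem
`det(I_k − 𝒜ℬ) = det(I_d − ℬ𝒜)` and eq. (4)). [cite: NetzerPlaumannThom2013, Thm. 3.1] -/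
theorem det_one_sub_ratRep [CharZero F] (K : Type*) [Field K] [Algebra (MvPolynomial ι F) K]
    [IsFractionRing (MvPolynomial ι F) K] (p : MvPolynomial ι F) {d : ℕ}
    (hp : MvPolynomial.constantCoeff p = 1) (hdeg : p.totalDegree = d) (hsq : Squarefree p)
    {q : MvPolynomial ι F} (hq : q ≠ 0) {k : ℕ} (Q : Matrix (Fin k) (Fin d) (MvPolynomial ι F))
    (hQ : Qᵀ * Q = q ^ 2 • paramHermite p d) :
    (1 - ratRep K p d q Q).det = algebraMap (MvPolynomial ι F) K p := by
  set φ := algebraMap (MvPolynomial ι F) K with hφ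
  have hφinj : Function.Injective φ := IsFractionRing.injective _ _
  have hq2 : φ (q ^ 2) ≠ 0 := (map_ne_zero_iff φ hφinj).mpr (pow_ne_zero 2 hq)
  set QK := Q.map φ with hQK
  set LK := (compL p d).map φ with hLK
  set HK := (paramHermite p d).map φ with hHK
  have hdetH : IsUnit HK.det := by
    refine Ne.isUnit ?_
    rw [hHK, ← RingHom.mapMatrix_apply, ← RingHom.map_det]
    exact (map_ne_zero_iff φ hφinj).mpr
      (det_paramHermite_ne_zero p hp hdeg.le (separable_homogenization_of_squarefree p hp hdeg hsq))
  have hgram : QKᵀ * QK = φ (q ^ 2) • HK := by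
    rw [hQK, ← Matrix.transpose_map, ← Matrix.map_mul, hQ, hHK]
    ext i j
    simp [Matrix.map_apply, Matrix.smul_apply]
  have hrep : ratRep K p d q Q = ((φ (q ^ 2))⁻¹ • (QK * LK * HK⁻¹)) * QKᵀ := by
    rw [ratRep, Matrix.smul_mul]
  have h1 : (1 - compL p d).map φ = 1 - LK := by
    rw [hLK]
    ext i j
    by_cases h : i = j <;> simp [h]
  rw [hrep, Matrix.det_one_sub_mul_comm, Matrix.mul_smul, ← Matrix.mul_assoc, ← Matrix.mul_assoc,
    hgram, Matrix.smul_mul, Matrix.smul_mul, smul_smul, inv_mul_cancel₀ hq2, one_smul,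
    Matrix.det_one_sub_mul_comm, ← Matrix.mul_assoc, Matrix.nonsing_inv_mul _ hdetH, Matrix.one_mul,
    ← h1, ← RingHom.mapMatrix_apply, ← RingHom.map_det, det_one_sub_compL p hp hdeg.le]

/-- **NPT 2013, Theorem 3.1 (symmetry).** The matrix `𝓜 = q⁻²𝒬𝓛_t𝓗⁻¹𝒬ᵀ` is symmetric — by
Lemma 2.2, `𝓛ᵀ𝓗 = 𝓗𝓛`. [cite: NetzerPlaumannThom2013, Thm. 3.1] -/
theorem ratRep_isSymm [CharZero F] (K : Type*) [Field K] [Algebra (MvPolynomial ι F) K]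
    [IsFractionRing (MvPolynomial ι F) K] (p : MvPolynomial ι F) {d : ℕ}
    (hp : MvPolynomial.constantCoeff p = 1) (hdeg : p.totalDegree = d) (hsq : Squarefree p)
    (q : MvPolynomial ι F) {k : ℕ} (Q : Matrix (Fin k) (Fin d) (MvPolynomial ι F)) :
    (ratRep K p d q Q).IsSymm := by
  set φ := algebraMap (MvPolynomial ι F) K with hφ
  have hφinj : Function.Injective φ := IsFractionRing.injective _ _
  set QK := Q.map φ with hQK
  set LK := (compL p d).map φ with hLK
  set HK := (paramHermite p d).map φ with hHK
  have hdetH : IsUnit HK.det := by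
    refine Ne.isUnit ?_
    rw [hHK, ← RingHom.mapMatrix_apply, ← RingHom.map_det]
    exact (map_ne_zero_iff φ hφinj).mpr
      (det_paramHermite_ne_zero p hp hdeg.le (separable_homogenization_of_squarefree p hp hdeg hsq))
  have hHsymm : HKᵀ = HK := by
    rw [hHK, ← Matrix.transpose_map, (paramHermite_isSymm p d).eq]
  have hL22 : LKᵀ * HK = HK * LK := by
    rw [hLK, hHK, ← Matrix.transpose_map, ← Matrix.map_mul, lemma_2_2 p hdeg.le, Matrix.map_mul]
  have hcomm : HK⁻¹ * LKᵀ = LK * HK⁻¹ := by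
    calc HK⁻¹ * LKᵀ = HK⁻¹ * (LKᵀ * HK) * HK⁻¹ := by
          rw [Matrix.mul_assoc, Matrix.mul_assoc, Matrix.mul_nonsing_inv _ hdetH, Matrix.mul_one]
      _ = LK * HK⁻¹ := by
          rw [hL22, ← Matrix.mul_assoc, Matrix.nonsing_inv_mul _ hdetH, Matrix.one_mul]
  unfold Matrix.IsSymm
  rw [ratRep, transpose_smul, transpose_mul, transpose_mul, transpose_mul, transpose_transpose,
    transpose_nonsing_inv, ← hQK, ← hLK, ← hHK, hHsymm, ← Matrix.mul_assoc, ← Matrix.mul_assoc,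
    Matrix.mul_assoc QK, hcomm, ← Matrix.mul_assoc]

end Thm31


/-! ## Example 2.8: quadratic polynomials -/

section Example28

open Literature.Algebra.Polynomial.SosMatrix

variable {m n : ℕ}

/-- The arrow-matrix determinant used in Example 2.8, division-free:
`det [[a, uᵀ],[u, c·I_n]] · c = c^n (a c − uᵀu)`. [cite: NetzerPlaumannThom2013, Example 2.8] -/
theorem det_arrow_mul {R : Type*} [CommRing R] (a c : R) (u : Fin n → R) :
    (Matrix.fromBlocks (Matrix.of fun (_ _ : Unit) => a) (Matrix.of fun (_ : Unit) i => u i)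
      (Matrix.of fun i (_ : Unit) => u i) (c • (1 : Matrix (Fin n) (Fin n) R))).det * c =
      c ^ n * (a * c - u ⬝ᵥ u) := by
  set X := Matrix.fromBlocks (Matrix.of fun (_ _ : Unit) => a) (Matrix.of fun (_ : Unit) i => u i)
      (Matrix.of fun i (_ : Unit) => u i) (c • (1 : Matrix (Fin n) (Fin n) R)) with hX
  set E : Matrix (Unit ⊕ Fin n) (Unit ⊕ Fin n) R :=
    Matrix.fromBlocks (c • (1 : Matrix Unit Unit R)) 0 (Matrix.of fun i (_ : Unit) => -u i) 1 with hE
  have hdetE : E.det = c := by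
    rw [hE, Matrix.det_fromBlocks_zero₁₂, det_one, mul_one, det_smul, det_one, mul_one,
      Fintype.card_unit, pow_one]
  have hXE : X * E = Matrix.fromBlocks (Matrix.of fun (_ _ : Unit) => a * c - u ⬝ᵥ u)
      (Matrix.of fun (_ : Unit) i => u i) 0 (c • (1 : Matrix (Fin n) (Fin n) R)) := by
    rw [hX, hE, Matrix.fromBlocks_multiply]
    simp only [Matrix.mul_zero, zero_add, Matrix.mul_one]
    congr 1
    · ext i j
      simp [Matrix.mul_apply, dotProduct, Finset.sum_neg_distrib, sub_eq_add_neg]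
      ring
    · ext i j
      simp
  calc X.det * c = (X * E).det := by rw [det_mul, hdetE]
    _ = c ^ n * (a * c - u ⬝ᵥ u) := by
        rw [hXE, Matrix.det_fromBlocks_zero₂₁, det_smul, det_one, mul_one, Fintype.card_fin,
          Matrix.det_unique, Matrix.of_apply, mul_comm]

/-- The matrix `𝒬 = √2 · [[1, −½bᵀx], [0, ½vᵢᵀx]ᵢ]` of Example 2.8 (rows indexed by
`Unit ⊕ Fin n`: the first row, then one row per vector `vᵢ`). [cite: NetzerPlaumannThom2013, Example 2.8] -/
def ex28Q (b : Fin m → ℝ) (v : Fin n → Fin m → ℝ) : Matrix (Unit ⊕ Fin n) (Fin 2) (MvPolynomial (Fin m) ℝ) :=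
  Matrix.of (Sum.elim (fun _ => ![MvPolynomial.C (Real.sqrt 2), -(MvPolynomial.C (Real.sqrt 2 / 2) * linForm b)])
    (fun i => ![0, MvPolynomial.C (Real.sqrt 2 / 2) * linForm (v i)]))

/-- The linear symmetric matrix polynomial
`𝓜 = ½ [[−bᵀx, v₁ᵀx, …, vₙᵀx], [v₁ᵀx, −bᵀx, 0, …], …, [vₙᵀx, 0, …, −bᵀx]]` of Example 2.8.
[cite: NetzerPlaumannThom2013, Example 2.8] -/
def ex28M (b : Fin m → ℝ) (v : Fin n → Fin m → ℝ) :
    Matrix (Unit ⊕ Fin n) (Unit ⊕ Fin n) (MvPolynomial (Fin m) ℝ) :=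
  Matrix.fromBlocks (Matrix.of fun _ _ => -(MvPolynomial.C (2⁻¹ : ℝ) * linForm b))
    (Matrix.of fun _ i => MvPolynomial.C (2⁻¹ : ℝ) * linForm (v i))
    (Matrix.of fun i _ => MvPolynomial.C (2⁻¹ : ℝ) * linForm (v i))
    ((-(MvPolynomial.C (2⁻¹ : ℝ) * linForm b)) • (1 : Matrix (Fin n) (Fin n) (MvPolynomial (Fin m) ℝ)))

/-- `𝓜` of Example 2.8 is symmetric. [cite: NetzerPlaumannThom2013, Example 2.8] -/
theorem ex28M_isSymm (b : Fin m → ℝ) (v : Fin n → Fin m → ℝ) : (ex28M b v).IsSymm := by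
  unfold Matrix.IsSymm ex28M
  rw [Matrix.fromBlocks_transpose]
  congr 1
  rw [transpose_smul, transpose_one]

/-- **Example 2.8, the decomposition `𝓗(p) = 𝒬ᵀ𝒬` (`q = 1`).** For `p = xᵀAx + bᵀx + 1` with
`bbᵀ − 4A = Σᵢ vᵢvᵢᵀ`, `𝒬ᵀ𝒬 = 𝓗(p)` (this is `2·𝒬₀ᵀ𝒬₀` of Example 1.8 with `𝒬 = √2 𝒬₀`).
[cite: NetzerPlaumannThom2013, Example 2.8] -/
theorem ex28Q_gram (A : Matrix (Fin m) (Fin m) ℝ) (b : Fin m → ℝ) (v : Fin n → Fin m → ℝ)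
    (hv : vecMulVec b b - (4 : ℝ) • A = ∑ i, vecMulVec (v i) (v i)) :
    (ex28Q b v)ᵀ * ex28Q b v = (1 : MvPolynomial (Fin m) ℝ) ^ 2 • paramHermite (quadPoly A b) 2 := by
  have hsq := sum_linForm_sq A b v hv
  -- constants
  have c1 : (MvPolynomial.C (Real.sqrt 2) : MvPolynomial (Fin m) ℝ) * MvPolynomial.C (Real.sqrt 2) = 2 := by
    rw [← map_mul, Real.mul_self_sqrt (by norm_num : (0 : ℝ) ≤ 2), map_ofNat]
  have c2 : (MvPolynomial.C (Real.sqrt 2) : MvPolynomial (Fin m) ℝ) * MvPolynomial.C (Real.sqrt 2 / 2) = 1 := by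
    rw [← map_mul, mul_div_assoc', Real.mul_self_sqrt (by norm_num : (0 : ℝ) ≤ 2), div_self two_ne_zero,
      map_one]
  have c3 : (MvPolynomial.C (Real.sqrt 2 / 2) : MvPolynomial (Fin m) ℝ) * MvPolynomial.C (Real.sqrt 2 / 2) * 2 = 1 := by
    rw [← map_mul, show (2 : MvPolynomial (Fin m) ℝ) = MvPolynomial.C 2 from (map_ofNat _ 2).symm,
      ← map_mul, div_mul_div_comm, Real.mul_self_sqrt (by norm_num : (0 : ℝ) ≤ 2)]
    norm_num
  rw [one_pow, one_smul, paramHermite_quadPoly]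
  refine Matrix.ext fun i j => ?_
  rw [Matrix.mul_apply, Fintype.sum_sum_type, Finset.univ_unique, Finset.sum_singleton]
  simp only [ex28Q, transpose_apply, Matrix.of_apply, Sum.elim_inl, Sum.elim_inr]
  fin_cases i <;> fin_cases j
  · simp
    linear_combination c1
  · simp
    linear_combination (linForm b) * c2
  · simp
    linear_combination (linForm b) * c2
  · simp only [Fin.mk_one, Fin.isValue, Matrix.cons_val_one, Matrix.cons_val_fin_one]
    have hS : ∑ x : Fin n, MvPolynomial.C (Real.sqrt 2 / 2) * linForm (v x) *
        (MvPolynomial.C (Real.sqrt 2 / 2) * linForm (v x)) =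
        MvPolynomial.C (Real.sqrt 2 / 2) * MvPolynomial.C (Real.sqrt 2 / 2) * ∑ x : Fin n, linForm (v x) ^ 2 := by
      rw [Finset.mul_sum]
      refine Finset.sum_congr rfl fun x _ => ?_
      ring
    rw [hS]
    linear_combination (linForm b ^ 2 - 2 * quadForm' A) * c3
      + (MvPolynomial.C (Real.sqrt 2 / 2) * MvPolynomial.C (Real.sqrt 2 / 2)) * hsq

/-- `𝓛_t` for the quadratic `p = xᵀAx + bᵀx + 1`: `[[0, −xᵀAx], [1, −bᵀx]]`.
[cite: NetzerPlaumannThom2013, Example 2.8] -/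
theorem compL_quadPoly (A : Matrix (Fin m) (Fin m) ℝ) (b : Fin m → ℝ) :
    compL (quadPoly A b) 2 = !![0, -quadForm' A; 1, -linForm b] := by
  refine Matrix.ext fun i j => ?_
  fin_cases i <;> fin_cases j <;> simp [compL_apply, homogeneousComponent_quadPoly]

/-- **Example 2.8, the commuting square `𝓜𝒬 = 𝒬𝓛_t`** («it is now easy to find a homogeneous
linear matrix polynomial `𝓜` that makes the diagram in Theorem 2.5 commute»).
[cite: NetzerPlaumannThom2013, Example 2.8] -/
theorem ex28_comm (A : Matrix (Fin m) (Fin m) ℝ) (b : Fin m → ℝ) (v : Fin n → Fin m → ℝ)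
    (hv : vecMulVec b b - (4 : ℝ) • A = ∑ i, vecMulVec (v i) (v i)) :
    ex28M b v * ex28Q b v = ex28Q b v * compL (quadPoly A b) 2 := by
  have hsq := sum_linForm_sq A b v hv
  have hu : (MvPolynomial.C (2⁻¹ : ℝ) : MvPolynomial (Fin m) ℝ) * 2 = 1 := by
    rw [show (2 : MvPolynomial (Fin m) ℝ) = MvPolynomial.C 2 from (map_ofNat _ 2).symm, ← map_mul]
    norm_num
  have d1 : (MvPolynomial.C (2⁻¹ : ℝ) : MvPolynomial (Fin m) ℝ) * MvPolynomial.C (Real.sqrt 2) =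
      MvPolynomial.C (Real.sqrt 2 / 2) := by
    rw [← map_mul]; congr 1; ring
  have d2 : (MvPolynomial.C (Real.sqrt 2 / 2) : MvPolynomial (Fin m) ℝ) * 2 = MvPolynomial.C (Real.sqrt 2) := by
    rw [show (2 : MvPolynomial (Fin m) ℝ) = MvPolynomial.C 2 from (map_ofNat _ 2).symm, ← map_mul]
    congr 1; ring
  rw [compL_quadPoly]
  refine Matrix.ext fun r c => ?_
  rw [Matrix.mul_apply, Matrix.mul_apply, Fintype.sum_sum_type, Finset.univ_unique,
    Finset.sum_singleton, Fin.sum_univ_two]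
  rcases r with r | l <;> fin_cases c
  · simp [ex28M, ex28Q]
    linear_combination (linForm b) * d1
  · simp only [ex28M, ex28Q, Matrix.fromBlocks_apply₁₁, Matrix.fromBlocks_apply₁₂, Matrix.of_apply,
      Sum.elim_inl, Sum.elim_inr, Fin.mk_one, Fin.isValue, Matrix.cons_val_one, Matrix.cons_val_fin_one,
      Matrix.cons_val_zero, Matrix.of_apply, Matrix.cons_val', Matrix.empty_val']
    have hS : ∑ x : Fin n, MvPolynomial.C (2⁻¹ : ℝ) * linForm (v x) *
        (MvPolynomial.C (Real.sqrt 2 / 2) * linForm (v x)) =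
        MvPolynomial.C (2⁻¹ : ℝ) * MvPolynomial.C (Real.sqrt 2 / 2) * ∑ x : Fin n, linForm (v x) ^ 2 := by
      rw [Finset.mul_sum]
      refine Finset.sum_congr rfl fun x _ => ?_
      ring
    rw [hS]
    linear_combination (MvPolynomial.C (Real.sqrt 2 / 2) * (linForm b ^ 2 - 2 * quadForm' A)) * hu
      + (-quadForm' A) * d2 + (MvPolynomial.C (2⁻¹ : ℝ) * MvPolynomial.C (Real.sqrt 2 / 2)) * hsq
  · simp [ex28M, ex28Q]
    linear_combination (linForm (v l)) * d1
  · simp [ex28M, ex28Q, Matrix.one_apply]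
    linear_combination (-(MvPolynomial.C (Real.sqrt 2 / 2) * linForm (v l) * linForm b)) * hu

/-- `I − 𝓜` of Example 2.8 is the arrow matrix `[[1 + ½bᵀx, −½vᵢᵀx], [−½vᵢᵀx, (1 + ½bᵀx) I]]`.
[cite: NetzerPlaumannThom2013, Example 2.8] -/
theorem one_sub_ex28M (b : Fin m → ℝ) (v : Fin n → Fin m → ℝ) :
    1 - ex28M b v = Matrix.fromBlocks
      (Matrix.of fun (_ _ : Unit) => 1 + MvPolynomial.C (2⁻¹ : ℝ) * linForm b)
      (Matrix.of fun (_ : Unit) i => -(MvPolynomial.C (2⁻¹ : ℝ) * linForm (v i)))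
      (Matrix.of fun i (_ : Unit) => -(MvPolynomial.C (2⁻¹ : ℝ) * linForm (v i)))
      ((1 + MvPolynomial.C (2⁻¹ : ℝ) * linForm b) • (1 : Matrix (Fin n) (Fin n) (MvPolynomial (Fin m) ℝ))) := by
  ext (i | i) (j | j)
  · simp [ex28M, sub_neg_eq_add]
  · simp [ex28M]
  · simp [ex28M]
  · by_cases h : i = j
    · subst h; simp [ex28M]
    · simp [ex28M, h]

/-- **Example 2.8, the resulting determinantal representation**, in division-free form:
`det(I − 𝓜) · (1 + ½bᵀx) = (1 + ½bᵀx)^n · p` (for `n ≥ 1` vectors `vᵢ`: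
`det(I − 𝓜) = (1 + ½bᵀx)^{n−1} p`, see `ex28_det'`). [cite: NetzerPlaumannThom2013, Example 2.8] -/
theorem ex28_det (A : Matrix (Fin m) (Fin m) ℝ) (b : Fin m → ℝ) (v : Fin n → Fin m → ℝ)
    (hv : vecMulVec b b - (4 : ℝ) • A = ∑ i, vecMulVec (v i) (v i)) :
    (1 - ex28M b v).det * (1 + MvPolynomial.C (2⁻¹ : ℝ) * linForm b) =
      (1 + MvPolynomial.C (2⁻¹ : ℝ) * linForm b) ^ n * quadPoly A b := by
  have hsq := sum_linForm_sq A b v hv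
  have hu : (MvPolynomial.C (2⁻¹ : ℝ) : MvPolynomial (Fin m) ℝ) * 2 = 1 := by
    rw [show (2 : MvPolynomial (Fin m) ℝ) = MvPolynomial.C 2 from (map_ofNat _ 2).symm, ← map_mul]
    norm_num
  rw [one_sub_ex28M, det_arrow_mul]
  have hdot : (fun i => -(MvPolynomial.C (2⁻¹ : ℝ) * linForm (v i))) ⬝ᵥ
      (fun i => -(MvPolynomial.C (2⁻¹ : ℝ) * linForm (v i))) =
      MvPolynomial.C (2⁻¹ : ℝ) * MvPolynomial.C (2⁻¹ : ℝ) * ∑ i, linForm (v i) ^ 2 := by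
    simp only [dotProduct, neg_mul_neg, Finset.mul_sum]
    refine Finset.sum_congr rfl fun i _ => ?_
    ring
  rw [hdot]
  have hp : quadPoly A b = quadForm' A + linForm b + 1 := rfl
  rw [hp]
  linear_combination ((1 + MvPolynomial.C (2⁻¹ : ℝ) * linForm b) ^ n *
      (linForm b + (2 * MvPolynomial.C (2⁻¹ : ℝ) + 1) * quadForm' A)) * hu
    + (-((1 + MvPolynomial.C (2⁻¹ : ℝ) * linForm b) ^ n *
        (MvPolynomial.C (2⁻¹ : ℝ) * MvPolynomial.C (2⁻¹ : ℝ)))) * hsq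

/-- **Example 2.8 as printed**: `det(I − 𝓜) = (1 + ½bᵀx)^{n−1} · p` for `n ≥ 1`.
[cite: NetzerPlaumannThom2013, Example 2.8] -/
theorem ex28_det' (A : Matrix (Fin m) (Fin m) ℝ) (b : Fin m → ℝ) (v : Fin n → Fin m → ℝ)
    (hv : vecMulVec b b - (4 : ℝ) • A = ∑ i, vecMulVec (v i) (v i)) (hn : 1 ≤ n) :
    (1 - ex28M b v).det = (1 + MvPolynomial.C (2⁻¹ : ℝ) * linForm b) ^ (n - 1) * quadPoly A b := by
  have hc : (1 + MvPolynomial.C (2⁻¹ : ℝ) * linForm b : MvPolynomial (Fin m) ℝ) ≠ 0 := by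
    intro h
    have h1 := congr_arg MvPolynomial.constantCoeff h
    rw [map_add, map_one, map_mul, MvPolynomial.constantCoeff_C, map_zero] at h1
    have h2 : MvPolynomial.constantCoeff (linForm b) = 0 := by
      simp [linForm, map_sum]
    rw [h2, mul_zero, add_zero] at h1
    exact one_ne_zero h1
  apply mul_right_cancel₀ hc
  rw [ex28_det A b v hv, mul_assoc, mul_comm (quadPoly A b), ← mul_assoc, ← pow_succ,
    Nat.sub_add_cancel hn]

end Example28

/-! ## Graded bookkeeping: lowest homogeneous parts of products -/

section Graded

variable {R : Type*} [CommRing R] {σ : Type*}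

/-- Expansion of a homogeneous component of a product along the components of the factors.
[folklore] -/
private theorem homogeneousComponent_mul_eq_sum (φ ψ : MvPolynomial σ R) (n : ℕ) :
    MvPolynomial.homogeneousComponent n (φ * ψ) =
      ∑ i ∈ range (φ.totalDegree + 1), ∑ j ∈ range (ψ.totalDegree + 1),
        if i + j = n then MvPolynomial.homogeneousComponent i φ * MvPolynomial.homogeneousComponent j ψ
        else 0 := by
  conv_lhs => rw [← MvPolynomial.sum_homogeneousComponent φ, ← MvPolynomial.sum_homogeneousComponent ψ,
    Finset.sum_mul_sum, map_sum]
  refine Finset.sum_congr rfl fun i _ => ?_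
  rw [map_sum]
  refine Finset.sum_congr rfl fun j _ => ?_
  have hmem : MvPolynomial.homogeneousComponent i φ * MvPolynomial.homogeneousComponent j ψ ∈
      MvPolynomial.homogeneousSubmodule σ R (i + j) :=
    (MvPolynomial.homogeneousComponent_isHomogeneous i φ).mul
      (MvPolynomial.homogeneousComponent_isHomogeneous j ψ)
  rw [MvPolynomial.homogeneousComponent_of_mem hmem]
  by_cases h : i + j = n
  · rw [if_pos h, if_pos h.symm]
  · rw [if_neg h, if_neg (Ne.symm h)]

/-- If `φ` has no homogeneous parts below degree `a` and `ψ` none below `b`, then `φψ` has none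
below `a + b`. [folklore] -/
private theorem homogeneousComponent_mul_eq_zero_of_lt (φ ψ : MvPolynomial σ R) (a b : ℕ)
    (hφ : ∀ k < a, MvPolynomial.homogeneousComponent k φ = 0)
    (hψ : ∀ k < b, MvPolynomial.homogeneousComponent k ψ = 0) :
    ∀ k < a + b, MvPolynomial.homogeneousComponent k (φ * ψ) = 0 := by
  intro k hk
  rw [homogeneousComponent_mul_eq_sum]
  refine Finset.sum_eq_zero fun i _ => Finset.sum_eq_zero fun j _ => ?_
  split_ifs with h
  · by_cases hi : i < a
    · rw [hφ i hi, zero_mul]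
    · rw [hψ j (by omega), mul_zero]
  · rfl

/-- … and the part of degree `a + b` of `φψ` is the product of the parts of degrees `a` and `b`.
[folklore] -/
private theorem homogeneousComponent_mul_add (φ ψ : MvPolynomial σ R) (a b : ℕ)
    (hφ : ∀ k < a, MvPolynomial.homogeneousComponent k φ = 0)
    (hψ : ∀ k < b, MvPolynomial.homogeneousComponent k ψ = 0) :
    MvPolynomial.homogeneousComponent (a + b) (φ * ψ) =
      MvPolynomial.homogeneousComponent a φ * MvPolynomial.homogeneousComponent b ψ := by
  rw [homogeneousComponent_mul_eq_sum]
  have hterm : ∀ i j, (if i + j = a + b then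
      MvPolynomial.homogeneousComponent i φ * MvPolynomial.homogeneousComponent j ψ else 0)
        = if i = a ∧ j = b then
          MvPolynomial.homogeneousComponent a φ * MvPolynomial.homogeneousComponent b ψ else 0 := by
    intro i j
    by_cases hij : i = a ∧ j = b
    · rw [if_pos hij, if_pos (by omega), hij.1, hij.2]
    · rw [if_neg hij]
      split_ifs with h
      · by_cases hi : i < a
        · rw [hφ i hi, zero_mul]
        · rw [hψ j (by omega), mul_zero]
      · rfl
  simp_rw [hterm]
  by_cases ha : a < φ.totalDegree + 1
  · by_cases hb : b < ψ.totalDegree + 1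
    · rw [Finset.sum_eq_single a, Finset.sum_eq_single b]
      · simp
      · intro j _ hj; rw [if_neg (fun h => hj h.2)]
      · intro h; exact absurd (Finset.mem_range.mpr hb) h
      · intro i _ hi
        exact Finset.sum_eq_zero fun j _ => by rw [if_neg (fun h => hi h.1)]
      · intro h; exact absurd (Finset.mem_range.mpr ha) h
    · rw [MvPolynomial.homogeneousComponent_eq_zero b ψ (by omega), mul_zero]
      refine Finset.sum_eq_zero fun i _ => Finset.sum_eq_zero fun j hj => ?_
      rw [Finset.mem_range] at hj
      rw [if_neg]
      rintro ⟨-, rfl⟩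
      exact hb hj
  · rw [MvPolynomial.homogeneousComponent_eq_zero a φ (by omega), zero_mul]
    refine Finset.sum_eq_zero fun i hi => Finset.sum_eq_zero fun j _ => ?_
    rw [Finset.mem_range] at hi
    rw [if_neg]
    rintro ⟨rfl, -⟩
    exact ha hi

/-- A homogeneous polynomial of degree `b` has no parts below degree `b`. [folklore] -/
private theorem homogeneousComponent_eq_zero_of_isHomogeneous {ψ : MvPolynomial σ R} {b : ℕ}
    (hψ : ψ.IsHomogeneous b) : ∀ k < b, MvPolynomial.homogeneousComponent k ψ = 0 := by
  intro k hk
  rw [MvPolynomial.homogeneousComponent_of_mem hψ, if_neg (by omega)]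

/-- Over `ℝ`, a finite sum of squares of polynomials vanishes only if each polynomial does.
[folklore] -/
private theorem eq_zero_of_sum_sq_eq_zero {L : Type*} (s : Finset L) (f : L → MvPolynomial σ ℝ)
    (h : ∑ l ∈ s, f l ^ 2 = 0) : ∀ l ∈ s, f l = 0 := by
  intro l hl
  apply MvPolynomial.funext
  intro x
  have hx := congr_arg (MvPolynomial.eval x) h
  rw [map_sum, map_zero] at hx
  simp only [map_pow] at hx
  have := (Finset.sum_eq_zero_iff_of_nonneg fun i _ =>
    sq_nonneg (MvPolynomial.eval x (f i))).mp hx l hl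
  rw [map_zero]
  exact pow_eq_zero_iff two_ne_zero |>.mp this

end Graded

/-! ## Degrees of the entries of `𝓗(p)`, `det 𝓗(p)` and `adj 𝓗(p)` -/

section Degrees

variable {R : Type*} [CommRing R] {ι : Type*}

/-- The Newton sums `N_k` built from forms `c_k` of degree `k` are forms of degree `k`.
[cite: NetzerPlaumannThom2013, §1 («the entries of 𝓗(p) are homogeneous»)] -/
theorem newtonOfCoeff_isHomogeneous {c : ℕ → MvPolynomial ι R} (hc : ∀ k, (c k).IsHomogeneous k)
    (d : ℕ) : ∀ k, (newtonOfCoeff d c k).IsHomogeneous k := by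
  intro k
  induction k using Nat.strong_induction_on with
  | _ k ih =>
    cases k with
    | zero =>
      rw [newtonOfCoeff_zero, ← map_natCast MvPolynomial.C d]
      exact MvPolynomial.isHomogeneous_C _ _
    | succ k =>
      rw [newtonOfCoeff_succ]
      refine (MvPolynomial.IsHomogeneous.add ?_ ?_).neg
      · have h := (MvPolynomial.isHomogeneous_C ι (((k + 1 : ℕ) : R))).mul (hc (k + 1))
        rwa [map_natCast, zero_add] at h
      · refine MvPolynomial.IsHomogeneous.sum _ _ _ fun i _ => ?_
        have h := (hc ((i : ℕ) + 1)).mul (ih (k - i) (by omega))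
        rwa [show (i : ℕ) + 1 + (k - i) = k + 1 by omega] at h

/-- The `(i,j)` entry of `𝓗(p)` is a form of degree `i + j` («the `i`-th diagonal entry in `𝓗(p)`
is homogeneous of degree `2(i−1)`», 1-indexed). [cite: NetzerPlaumannThom2013, proof of Lemma 2.1] -/
theorem paramHermite_isHomogeneous (p : MvPolynomial ι R) (d : ℕ) (i j : Fin d) :
    (paramHermite p d i j).IsHomogeneous ((i : ℕ) + j) := by
  rw [paramHermite_apply]
  exact newtonOfCoeff_isHomogeneous (fun k => MvPolynomial.homogeneousComponent_isHomogeneous k p) d _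

/-- Leibniz: if the `(i,j)` entry of `M` is a form of degree `r i + c j`, then `det M` is a form of
degree `Σ r + Σ c`. [folklore] -/
private theorem isHomogeneous_det_of_apply {n : Type*} [Fintype n] [DecidableEq n]
    (M : Matrix n n (MvPolynomial ι R)) (r c : n → ℕ)
    (h : ∀ i j, (M i j).IsHomogeneous (r i + c j)) :
    M.det.IsHomogeneous (∑ i, r i + ∑ i, c i) := by
  rw [Matrix.det_apply]
  refine MvPolynomial.IsHomogeneous.sum _ _ _ fun τ _ => ?_
  have hp : (∏ i, M (τ i) i).IsHomogeneous (∑ i, r i + ∑ i, c i) := by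
    have := MvPolynomial.IsHomogeneous.prod Finset.univ (fun i => M (τ i) i)
      (fun i => r (τ i) + c i) fun i _ => h _ _
    rwa [Finset.sum_add_distrib, Equiv.sum_comp τ r] at this
  rw [Units.smul_def]
  exact (MvPolynomial.mem_homogeneousSubmodule _ _).mp
    (zsmul_mem ((MvPolynomial.mem_homogeneousSubmodule _ _).mpr hp) _)

/-- Leibniz for the adjugate: with entries of degrees `r i + c j`, the `(i,j)` entry of `adj M` is
a form of degree `Σ r + Σ c − r j − c i`. [folklore] -/
private theorem isHomogeneous_adjugate_of_apply {n : Type*} [Fintype n] [DecidableEq n]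
    (M : Matrix n n (MvPolynomial ι R)) (r c : n → ℕ)
    (h : ∀ i j, (M i j).IsHomogeneous (r i + c j)) (i j : n) {N : ℕ}
    (hN : N + r j + c i = ∑ i, r i + ∑ i, c i) :
    (M.adjugate i j).IsHomogeneous N := by
  rw [Matrix.adjugate_apply, Matrix.det_apply]
  refine MvPolynomial.IsHomogeneous.sum _ _ _ fun τ _ => ?_
  by_cases hτ : τ i = j
  · have hp : (∏ k, M.updateRow j (Pi.single i 1) (τ k) k).IsHomogeneous N := by
      rw [← Finset.mul_prod_erase _ _ (Finset.mem_univ i), Matrix.updateRow_apply, if_pos hτ,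
        Pi.single_eq_same, one_mul]
      have hprod := MvPolynomial.IsHomogeneous.prod (Finset.univ.erase i)
        (fun k => M.updateRow j (Pi.single i 1) (τ k) k) (fun k => r (τ k) + c k) fun k hk => by
          have hki : k ≠ i := Finset.ne_of_mem_erase hk
          have hτk : τ k ≠ j := fun e => hki (τ.injective (e.trans hτ.symm))
          simp only [Matrix.updateRow_apply, if_neg hτk]
          exact h _ _
      have hsum : ∑ k ∈ Finset.univ.erase i, (r (τ k) + c k) = N := by
        have h1 := Finset.add_sum_erase Finset.univ (fun k => r (τ k) + c k) (Finset.mem_univ i)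
        have h2 : ∑ k, (r (τ k) + c k) = ∑ k, r k + ∑ k, c k := by
          rw [Finset.sum_add_distrib, Equiv.sum_comp τ r]
        rw [hτ] at h1
        omega
      rwa [hsum] at hprod
    rw [Units.smul_def]
    exact (MvPolynomial.mem_homogeneousSubmodule _ _).mp
      (zsmul_mem ((MvPolynomial.mem_homogeneousSubmodule _ _).mpr hp) _)
  · have h0 : ∏ k, M.updateRow j (Pi.single i 1) (τ k) k = 0 := by
      refine Finset.prod_eq_zero (Finset.mem_univ (τ.symm j)) ?_
      rw [Matrix.updateRow_apply, if_pos (τ.apply_symm_apply j)]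
      exact Pi.single_eq_of_ne (fun e => hτ (by rw [← e, Equiv.apply_symm_apply])) 1
    rw [h0, smul_zero]
    exact MvPolynomial.isHomogeneous_zero _ _ _

/-- `Σ_{i<d} i + Σ_{j<d} j = d(d−1)`. [folklore] -/
private theorem sum_fin_val_add_sum_fin_val (d : ℕ) :
    ∑ i : Fin d, (i : ℕ) + ∑ i : Fin d, (i : ℕ) = d * (d - 1) := by
  rw [Fin.sum_univ_eq_sum_range (fun i => i) d, ← mul_two, Finset.sum_range_id_mul_two]

/-- `det 𝓗(p)` is a form of degree `d(d−1)` (the degree structure of `𝓗(p)` used in the proof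
of Thm. 3.1). [cite: NetzerPlaumannThom2013, proof of Thm. 3.1] -/
theorem det_paramHermite_isHomogeneous (p : MvPolynomial ι R) (d : ℕ) :
    (paramHermite p d).det.IsHomogeneous (d * (d - 1)) := by
  rw [← sum_fin_val_add_sum_fin_val d]
  exact isHomogeneous_det_of_apply _ (fun i : Fin d => (i : ℕ)) (fun j : Fin d => (j : ℕ))
    (paramHermite_isHomogeneous p d)

/-- Index bound used for the adjugate degrees. [folklore] -/
private theorem fin_val_add_le (d : ℕ) (i j : Fin d) : (i : ℕ) + j ≤ d * (d - 1) := by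
  have hi := i.isLt
  have hj := j.isLt
  rcases Nat.lt_or_ge d 2 with hd | hd
  · interval_cases d
    · omega
    · omega
  · calc (i : ℕ) + j ≤ 2 * (d - 1) := by omega
      _ ≤ d * (d - 1) := Nat.mul_le_mul_right _ hd

/-- The `(i,j)` entry of `adj 𝓗(p)` is a form of degree `d(d−1) − i − j` (degree structure of
`𝓗(p)⁻¹ = adj 𝓗(p)/det 𝓗(p)` in the proof of Thm. 3.1). [cite: NetzerPlaumannThom2013, proof of Thm. 3.1] -/
theorem adjugate_paramHermite_isHomogeneous (p : MvPolynomial ι R) (d : ℕ) (i j : Fin d) :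
    ((paramHermite p d).adjugate i j).IsHomogeneous (d * (d - 1) - ((i : ℕ) + j)) := by
  refine isHomogeneous_adjugate_of_apply _ (fun i : Fin d => (i : ℕ)) (fun j : Fin d => (j : ℕ))
    (paramHermite_isHomogeneous p d) i j ?_
  rw [sum_fin_val_add_sum_fin_val]
  have := fin_val_add_le d i j
  omega

end Degrees

/-! ## Lemma 2.1: making `q` homogeneous (lowest-degree parts) -/

section Lemma21

variable {ι : Type*}

/-- `𝒬_min`: keep from each entry of the `i`-th column of `𝒬` only its homogeneous part of degree
`r + i` (0-indexed columns; printed `r + i − 1` with 1-indexed columns).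
[cite: NetzerPlaumannThom2013, proof of Lemma 2.1] -/
def minPart {R : Type*} [CommRing R] (r : ℕ) {k d : ℕ} (Q : Matrix (Fin k) (Fin d) (MvPolynomial ι R)) :
    Matrix (Fin k) (Fin d) (MvPolynomial ι R) :=
  Matrix.of fun l i => MvPolynomial.homogeneousComponent (r + i) (Q l i)

/-- Entries of `𝒬_min`. [cite: NetzerPlaumannThom2013, proof of Lemma 2.1] -/
theorem minPart_apply {R : Type*} [CommRing R] (r : ℕ) {k d : ℕ}
    (Q : Matrix (Fin k) (Fin d) (MvPolynomial ι R)) (l : Fin k) (i : Fin d) :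
    minPart r Q l i = MvPolynomial.homogeneousComponent (r + i) (Q l i) := rfl

/-- The entries of the `i`-th column of `𝒬_min` are forms of degree `r + i`.
[cite: NetzerPlaumannThom2013, proof of Lemma 2.1] -/
theorem minPart_isHomogeneous {R : Type*} [CommRing R] (r : ℕ) {k d : ℕ}
    (Q : Matrix (Fin k) (Fin d) (MvPolynomial ι R)) (l : Fin k) (i : Fin d) :
    (minPart r Q l i).IsHomogeneous (r + i) :=
  MvPolynomial.homogeneousComponent_isHomogeneous _ _

/-- **Degree structure of `𝒬` (proof of Lemma 2.1).** If `q` has no homogeneous parts below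
degree `r` and `q²𝓗(p) = 𝒬ᵀ𝒬` over `ℝ`, then the entries of the `i`-th column of `𝒬` have no
homogeneous parts below degree `r + i` («since the `i`-th diagonal entry in `𝓗(p)` is homogeneous
of degree `2(i−1)`, each entry in the `i`-th column of `𝒬` has homogeneous parts of degree between
`r+i−1` and `R+i−1`»; the lower bound, which is what the lemma uses).
[cite: NetzerPlaumannThom2013, proof of Lemma 2.1] -/
theorem homogeneousComponent_eq_zero_of_gram (p : MvPolynomial ι ℝ) (d : ℕ) {k : ℕ}
    {q : MvPolynomial ι ℝ} {r : ℕ} (hqr : ∀ n < r, MvPolynomial.homogeneousComponent n q = 0)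
    (Q : Matrix (Fin k) (Fin d) (MvPolynomial ι ℝ)) (hQ : Qᵀ * Q = q ^ 2 • paramHermite p d)
    (i : Fin d) (l : Fin k) : ∀ n < r + i, MvPolynomial.homogeneousComponent n (Q l i) = 0 := by
  by_contra hcon
  push Not at hcon
  classical
  -- the least degree `n₀ < r + i` in which some entry of column `i` has a non-zero part
  have hex : ∃ n, n < r + (i : ℕ) ∧ ∃ l', MvPolynomial.homogeneousComponent n (Q l' i) ≠ 0 := by
    obtain ⟨n, hn, hne⟩ := hcon
    exact ⟨n, hn, l, hne⟩
  set n₀ := Nat.find hex with hn₀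
  obtain ⟨hn₀lt, l₀, hl₀⟩ := Nat.find_spec hex
  have hmin : ∀ l', ∀ n < n₀, MvPolynomial.homogeneousComponent n (Q l' i) = 0 := by
    intro l' n hn
    by_contra hne
    exact Nat.find_min hex hn ⟨by omega, l', hne⟩
  -- compare the parts of degree `2 n₀` of the `i`-th diagonal entries of `𝒬ᵀ𝒬 = q²𝓗(p)`
  have hdiag := congr_fun (congr_fun hQ i) i
  rw [Matrix.mul_apply, Matrix.smul_apply, smul_eq_mul] at hdiag
  have hc := congr_arg (MvPolynomial.homogeneousComponent (n₀ + n₀)) hdiag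
  rw [map_sum] at hc
  have hlhs : ∑ l', MvPolynomial.homogeneousComponent (n₀ + n₀) (Qᵀ i l' * Q l' i) =
      ∑ l', MvPolynomial.homogeneousComponent n₀ (Q l' i) ^ 2 := by
    refine Finset.sum_congr rfl fun l' _ => ?_
    rw [Matrix.transpose_apply, homogeneousComponent_mul_add _ _ _ _ (hmin l') (hmin l'), sq]
  have hrhs : MvPolynomial.homogeneousComponent (n₀ + n₀) (q ^ 2 * paramHermite p d i i) = 0 := by
    have hq2 : ∀ n < r + r, MvPolynomial.homogeneousComponent n (q ^ 2) = 0 := by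
      rw [sq]; exact homogeneousComponent_mul_eq_zero_of_lt q q r r hqr hqr
    exact homogeneousComponent_mul_eq_zero_of_lt _ _ (r + r) ((i : ℕ) + i) hq2
      (homogeneousComponent_eq_zero_of_isHomogeneous (paramHermite_isHomogeneous p d i i)) _
      (by omega)
  rw [hlhs, hrhs] at hc
  exact hl₀ (eq_zero_of_sum_sq_eq_zero _ _ hc l₀ (Finset.mem_univ _))

/-- **NPT 2013, Lemma 2.1 (the homogenisation step, proved).** If `q` has no homogeneous parts
below degree `r` and `q²𝓗(p) = 𝒬ᵀ𝒬` over `ℝ`, then `q_r² 𝓗(p) = 𝒬_minᵀ𝒬_min`, where `q_r` is the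
part of `q` of degree `r` and `𝒬_min` keeps the parts of degree `r + i` in column `i` («compare
degrees on both sides»).  The existence of SOME decomposition `q²𝓗(p) = 𝒬ᵀ𝒬` for real-zero `p`
(Gondard–Ribenboim) is not formalised; this is the part of Lemma 2.1 proved in the source.
[cite: NetzerPlaumannThom2013, Lemma 2.1 (proof)] -/
theorem lemma_2_1_minPart (p : MvPolynomial ι ℝ) (d : ℕ) {k : ℕ} {q : MvPolynomial ι ℝ} {r : ℕ}
    (hqr : ∀ n < r, MvPolynomial.homogeneousComponent n q = 0)
    (Q : Matrix (Fin k) (Fin d) (MvPolynomial ι ℝ)) (hQ : Qᵀ * Q = q ^ 2 • paramHermite p d) :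
    (minPart r Q)ᵀ * minPart r Q =
      MvPolynomial.homogeneousComponent r q ^ 2 • paramHermite p d := by
  have hvan := homogeneousComponent_eq_zero_of_gram p d hqr Q hQ
  refine Matrix.ext fun i j => ?_
  have hij := congr_fun (congr_fun hQ i) j
  rw [Matrix.mul_apply, Matrix.smul_apply, smul_eq_mul] at hij
  rw [Matrix.mul_apply, Matrix.smul_apply, smul_eq_mul]
  have hq2 : ∀ n < r + r, MvPolynomial.homogeneousComponent n (q ^ 2) = 0 := by
    rw [sq]; exact homogeneousComponent_mul_eq_zero_of_lt q q r r hqr hqr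
  calc ∑ l, (minPart r Q)ᵀ i l * minPart r Q l j
      = ∑ l, MvPolynomial.homogeneousComponent (r + i + (r + j)) (Qᵀ i l * Q l j) := by
        refine Finset.sum_congr rfl fun l _ => ?_
        rw [Matrix.transpose_apply, Matrix.transpose_apply, minPart_apply, minPart_apply,
          homogeneousComponent_mul_add _ _ _ _ (hvan i l) (hvan j l)]
    _ = MvPolynomial.homogeneousComponent (r + i + (r + j)) (q ^ 2 * paramHermite p d i j) := by
        rw [← map_sum, hij]
    _ = MvPolynomial.homogeneousComponent (r + r) (q ^ 2) *
          MvPolynomial.homogeneousComponent ((i : ℕ) + j) (paramHermite p d i j) := by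
        rw [show r + (i : ℕ) + (r + j) = r + r + ((i : ℕ) + j) by omega]
        exact homogeneousComponent_mul_add _ _ _ _ hq2
          (homogeneousComponent_eq_zero_of_isHomogeneous (paramHermite_isHomogeneous p d i j))
    _ = MvPolynomial.homogeneousComponent r q ^ 2 * paramHermite p d i j := by
        rw [sq, sq, homogeneousComponent_mul_add q q r r hqr hqr,
          MvPolynomial.homogeneousComponent_of_mem (paramHermite_isHomogeneous p d i j), if_pos rfl]

/-- **NPT 2013, Lemma 2.1 (as used in Setup 2.4), relative to a given decomposition.** From ANY
decomposition `q²𝓗(p) = 𝒬ᵀ𝒬` with `q ≠ 0` over `ℝ` one obtains one with `q` homogeneous (of degree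
`r`, the least degree of a part of the given `q`) and the entries of the `i`-th column of `𝒬`
homogeneous of degree `r + i` (0-indexed).  [cite: NetzerPlaumannThom2013, Lemma 2.1 and Setup 2.4] -/
theorem lemma_2_1_of_decomposition (p : MvPolynomial ι ℝ) (d : ℕ) {k : ℕ} {q : MvPolynomial ι ℝ}
    (hq : q ≠ 0) (Q : Matrix (Fin k) (Fin d) (MvPolynomial ι ℝ))
    (hQ : Qᵀ * Q = q ^ 2 • paramHermite p d) :
    ∃ (r : ℕ) (q' : MvPolynomial ι ℝ) (Q' : Matrix (Fin k) (Fin d) (MvPolynomial ι ℝ)),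
      q'.IsHomogeneous r ∧ q' ≠ 0 ∧ (∀ l i, (Q' l i).IsHomogeneous (r + i)) ∧
        Q'ᵀ * Q' = q' ^ 2 • paramHermite p d := by
  classical
  have hex : ∃ n, MvPolynomial.homogeneousComponent n q ≠ 0 := by
    by_contra h
    push Not at h
    apply hq
    rw [← MvPolynomial.sum_homogeneousComponent q]
    exact Finset.sum_eq_zero fun n _ => h n
  refine ⟨Nat.find hex, MvPolynomial.homogeneousComponent (Nat.find hex) q, minPart (Nat.find hex) Q,
    MvPolynomial.homogeneousComponent_isHomogeneous _ _, Nat.find_spec hex,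
    fun l i => minPart_isHomogeneous _ Q l i, lemma_2_1_minPart p d ?_ Q hQ⟩
  intro n hn
  have := Nat.find_min hex hn
  simpa using this

end Lemma21

/-! ## Theorem 3.1: the entries of `𝓜` are homogeneous of degree `1` -/

section Thm31Degree

variable {F : Type*} [Field F] {ι : Type*}

/-- Homogeneity in the function field (§3): an element `e` of `K = F(x)` is *homogeneous of degree
`k`* if `e = f/g` with `f, g ∈ F[x]` BOTH homogeneous, «not necessarily of the same degree», and
`deg f − deg g = k` («the degree of a rational function `f/g` is defined as `deg(f) − deg(g)`»).
[cite: NetzerPlaumannThom2013, §3 (definitions before Thm. 3.1)] -/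
def IsHomogeneousRat {K : Type*} [Field K] (φ : MvPolynomial ι F →+* K) (e : K) (k : ℤ) : Prop :=
  ∃ (f g : MvPolynomial ι F) (a b : ℕ), f.IsHomogeneous a ∧ g.IsHomogeneous b ∧ g ≠ 0 ∧
    (a : ℤ) - b = k ∧ e * φ g = φ f

/-- A form of degree `a` is homogeneous of degree `a` as a rational function (`g = 1`).
[cite: NetzerPlaumannThom2013, §3 (definitions before Thm. 3.1)] -/
theorem isHomogeneousRat_map {K : Type*} [Field K] (φ : MvPolynomial ι F →+* K)
    {f : MvPolynomial ι F} {a : ℕ} (hf : f.IsHomogeneous a) :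
    IsHomogeneousRat φ (φ f) a :=
  ⟨f, 1, a, 0, hf, MvPolynomial.isHomogeneous_one ι F, one_ne_zero, by simp, by simp⟩

/-- `0` is homogeneous of every (non-negative) degree `a` (as `0 = 0/1`, `0` being a form of
every degree). [cite: NetzerPlaumannThom2013, §3 (definitions before Thm. 3.1)] -/
theorem isHomogeneousRat_zero {K : Type*} [Field K] (φ : MvPolynomial ι F →+* K) (a : ℕ) :
    IsHomogeneousRat φ (0 : K) a :=
  ⟨0, 1, a, 0, MvPolynomial.isHomogeneous_zero ι F a, MvPolynomial.isHomogeneous_one ι F,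
    one_ne_zero, by simp, by simp⟩

/-- A quotient `f/g` of forms is homogeneous of degree `deg f − deg g`.
[cite: NetzerPlaumannThom2013, §3 (definitions before Thm. 3.1)] -/
theorem isHomogeneousRat_div {K : Type*} [Field K] {φ : MvPolynomial ι F →+* K}
    (hφ : Function.Injective φ) {f g : MvPolynomial ι F} {a b : ℕ}
    (hf : f.IsHomogeneous a) (hg : g.IsHomogeneous b) (hg0 : g ≠ 0) :
    IsHomogeneousRat φ (φ f / φ g) ((a : ℤ) - b) := by
  refine ⟨f, g, a, b, hf, hg, hg0, rfl, ?_⟩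
  have : φ g ≠ 0 := fun h => hg0 (hφ ((map_zero φ).symm ▸ h))
  rw [div_mul_cancel₀ _ this]

/-- Over the function field (`φ` injective), `e` homogeneous of degree `k` means `e = f/g` for forms
`f, g` with `deg f − deg g = k`. [cite: NetzerPlaumannThom2013, §3 (definitions before Thm. 3.1)] -/
theorem IsHomogeneousRat.exists_eq_div {K : Type*} [Field K] {φ : MvPolynomial ι F →+* K}
    (hφ : Function.Injective φ) {e : K} {k : ℤ} (h : IsHomogeneousRat φ e k) :
    ∃ (f g : MvPolynomial ι F) (a b : ℕ), f.IsHomogeneous a ∧ g.IsHomogeneous b ∧ g ≠ 0 ∧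
      (a : ℤ) - b = k ∧ e = φ f / φ g := by
  obtain ⟨f, g, a, b, hf, hg, hg0, hab, he⟩ := h
  have : φ g ≠ 0 := fun h => hg0 (hφ ((map_zero φ).symm ▸ h))
  exact ⟨f, g, a, b, hf, hg, hg0, hab, by rw [eq_div_iff this, he]⟩

/-- Homogeneity of degree `k` is preserved by negation.
[cite: NetzerPlaumannThom2013, §3 (definitions before Thm. 3.1)] -/
theorem IsHomogeneousRat.neg {K : Type*} [Field K] {φ : MvPolynomial ι F →+* K} {e : K} {k : ℤ}
    (h : IsHomogeneousRat φ e k) : IsHomogeneousRat φ (-e) k := by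
  obtain ⟨f, g, a, b, hf, hg, hg0, hab, he⟩ := h
  exact ⟨-f, g, a, b, hf.neg, hg, hg0, hab, by rw [neg_mul, he, map_neg]⟩

/-- The numerator `𝒬 𝓛_t adj(𝓗(p)) 𝒬ᵀ` of `𝓜` (after clearing `q² det 𝓗(p)`) has entries that are
forms of degree `2r + d(d−1) + 1` when `𝒬` has the degree structure of Setup 2.4 (column `i`
homogeneous of degree `r + i`): degree structure of `𝒬`, `𝓛`, `𝓗` in the proof of Thm. 3.1.
[cite: NetzerPlaumannThom2013, proof of Thm. 3.1] -/
theorem ratRep_numerator_isHomogeneous (p : MvPolynomial ι F) (d : ℕ) {k r : ℕ}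
    (Q : Matrix (Fin k) (Fin d) (MvPolynomial ι F)) (hQh : ∀ l i, (Q l i).IsHomogeneous (r + i))
    (i j : Fin k) :
    ((Q * compL p d * (paramHermite p d).adjugate * Qᵀ) i j).IsHomogeneous
      (2 * r + d * (d - 1) + 1) := by
  simp only [Matrix.mul_apply, Matrix.transpose_apply, Finset.sum_mul]
  refine MvPolynomial.IsHomogeneous.sum _ _ _ fun c _ =>
    MvPolynomial.IsHomogeneous.sum _ _ _ fun b _ =>
      MvPolynomial.IsHomogeneous.sum _ _ _ fun a _ => ?_
  have hbc := fin_val_add_le d b c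
  have hadj := adjugate_paramHermite_isHomogeneous p d b c
  have ha := a.isLt
  rw [compL_apply]
  split_ifs with hb hab
  · -- last column of `𝓛_t`: `−p_{d−a}`, a form of degree `d − a`
    have hL : (-MvPolynomial.homogeneousComponent (d - a) p).IsHomogeneous (d - a) :=
      (MvPolynomial.homogeneousComponent_isHomogeneous _ p).neg
    have h := (((hQh i a).mul hL).mul hadj).mul (hQh j c)
    rwa [show r + (a : ℕ) + (d - a) + (d * (d - 1) - ((b : ℕ) + c)) + (r + c) =
      2 * r + d * (d - 1) + 1 by omega] at h
  · -- subdiagonal of `𝓛_t`: the entry `1`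
    have h := (((hQh i a).mul (MvPolynomial.isHomogeneous_one ι F)).mul hadj).mul (hQh j c)
    rwa [show r + (a : ℕ) + 0 + (d * (d - 1) - ((b : ℕ) + c)) + (r + c) =
      2 * r + d * (d - 1) + 1 by omega] at h
  · rw [mul_zero, zero_mul, zero_mul]
    exact MvPolynomial.isHomogeneous_zero _ _ _

/-- Clearing denominators in `𝓜 = q⁻²𝒬𝓛_t𝓗(p)⁻¹𝒬ᵀ`: when `q² det 𝓗(p) ≠ 0`,
`𝓜_{ij} · q² det 𝓗(p) = (𝒬 𝓛_t adj(𝓗(p)) 𝒬ᵀ)_{ij}` (`𝓗⁻¹ = adj 𝓗 / det 𝓗`).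
[cite: NetzerPlaumannThom2013, proof of Thm. 3.1] -/
theorem ratRep_apply_mul_denominator (K : Type*) [Field K] [Algebra (MvPolynomial ι F) K]
    (p : MvPolynomial ι F) (d : ℕ) (q : MvPolynomial ι F) {k : ℕ}
    (Q : Matrix (Fin k) (Fin d) (MvPolynomial ι F))
    (hne : algebraMap (MvPolynomial ι F) K (q ^ 2 * (paramHermite p d).det) ≠ 0) (i j : Fin k) :
    ratRep K p d q Q i j * algebraMap (MvPolynomial ι F) K (q ^ 2 * (paramHermite p d).det) =
      algebraMap (MvPolynomial ι F) K ((Q * compL p d * (paramHermite p d).adjugate * Qᵀ) i j) := by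
  set φ := algebraMap (MvPolynomial ι F) K with hφ
  have hdet : ((paramHermite p d).map φ).det = φ (paramHermite p d).det := by
    rw [RingHom.map_det, RingHom.mapMatrix_apply]
  have hadj : ((paramHermite p d).map φ).adjugate = ((paramHermite p d).adjugate).map φ := by
    rw [← RingHom.mapMatrix_apply, ← RingHom.map_adjugate, RingHom.mapMatrix_apply]
  have hinv : ((paramHermite p d).map φ)⁻¹ = (φ (paramHermite p d).det)⁻¹ • (paramHermite p d).adjugate.map φ := by
    rw [Matrix.inv_def, Ring.inverse_eq_inv, hdet, hadj]
  have hM : ratRep K p d q Q = ((φ (q ^ 2))⁻¹ * (φ (paramHermite p d).det)⁻¹) •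
      (Q * compL p d * (paramHermite p d).adjugate * Qᵀ).map φ := by
    rw [ratRep, ← hφ, hinv, Matrix.mul_smul, Matrix.smul_mul, smul_smul, Matrix.map_mul,
      Matrix.map_mul, Matrix.map_mul, Matrix.transpose_map]
  rw [hM, Matrix.smul_apply, Matrix.map_apply, smul_eq_mul, map_mul, ← mul_inv,
    mul_comm ((φ (q ^ 2) * φ (paramHermite p d).det)⁻¹), mul_assoc, inv_mul_cancel₀, mul_one]
  rwa [map_mul] at hne

/-- **NPT 2013, Theorem 3.1 (degree clause).** With `q` homogeneous of degree `r` and the entries of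
the `i`-th column of `𝒬` homogeneous of degree `r + i` (the degree structure of Setup 2.4 /
Lemma 2.1), every entry of `𝓜 = q⁻²𝒬𝓛_t𝓗(p)⁻¹𝒬ᵀ ∈ Mat_k(F(x))` is homogeneous of degree `1`: it is
`(𝒬 𝓛_t adj 𝓗 𝒬ᵀ)_{ij} / (q² det 𝓗)`, a quotient of forms of degrees `2r + d(d−1) + 1` and
`2r + d(d−1)` (printed via the scalings `𝒬(λa) = 𝒬(a)·diag(λ^{r+i})`, `𝓗(λa)`, `𝓛(λa)`).  No
hypothesis on `p` is needed (if `q² det 𝓗(p) = 0` then `𝓜 = 0`).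
[cite: NetzerPlaumannThom2013, Thm. 3.1] -/
theorem thm_3_1_isHomogeneousRat (K : Type*) [Field K] [Algebra (MvPolynomial ι F) K]
    (p : MvPolynomial ι F) (d : ℕ) {q : MvPolynomial ι F}
    {r : ℕ} (hqh : q.IsHomogeneous r) {k : ℕ} (Q : Matrix (Fin k) (Fin d) (MvPolynomial ι F))
    (hQh : ∀ l i, (Q l i).IsHomogeneous (r + i)) (i j : Fin k) :
    IsHomogeneousRat (algebraMap (MvPolynomial ι F) K) (ratRep K p d q Q i j) 1 := by
  by_cases hne : algebraMap (MvPolynomial ι F) K (q ^ 2 * (paramHermite p d).det) = 0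
  · -- degenerate case: `𝓜 = 0`
    have hM : ratRep K p d q Q = 0 := by
      rw [map_mul, mul_eq_zero] at hne
      rcases hne with hq | hdet
      · rw [ratRep, hq, _root_.inv_zero, zero_smul]
      · have hdet' : ¬IsUnit ((paramHermite p d).map (algebraMap (MvPolynomial ι F) K)).det := by
          rw [← RingHom.mapMatrix_apply, ← RingHom.map_det, hdet]
          exact not_isUnit_zero
        rw [ratRep, Matrix.nonsing_inv_apply_not_isUnit _ hdet', Matrix.mul_zero, Matrix.zero_mul,
          smul_zero]
    rw [hM, Matrix.zero_apply]
    exact isHomogeneousRat_zero _ 1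
  · refine ⟨(Q * compL p d * (paramHermite p d).adjugate * Qᵀ) i j, q ^ 2 * (paramHermite p d).det,
      2 * r + d * (d - 1) + 1, 2 * r + d * (d - 1),
      ratRep_numerator_isHomogeneous p d Q hQh i j, ?_,
      fun h => hne (by rw [h, map_zero]), by push_cast; ring,
      ratRep_apply_mul_denominator K p d q Q hne i j⟩
    have h := (hqh.mul hqh).mul (det_paramHermite_isHomogeneous p d)
    rwa [← sq, show r + r = 2 * r by ring] at h

/-- **NPT 2013, Theorem 3.1 (all three clauses), relative to a decomposition `q²𝓗(p) = 𝒬ᵀ𝒬`.**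
Let `p ∈ ℝ[x]` be square-free of degree `d` with `p(0) = 1`, and let `q²𝓗(p) = 𝒬ᵀ𝒬` with `q ≠ 0`
(for real-zero `p` such a decomposition exists by Gondard–Ribenboim — Lemma 2.1, whose existence half
is not formalised).  After making `q` homogeneous (Lemma 2.1, `lemma_2_1_of_decomposition`), the
matrix `𝓜 = q⁻²𝒬𝓛_t𝓗(p)⁻¹𝒬ᵀ` over `K = ℝ(x)` is symmetric, has entries homogeneous of degree `1`,
and `det(I − 𝓜) = p`. [cite: NetzerPlaumannThom2013, Thm. 3.1] -/
theorem thm_3_1 (K : Type*) [Field K] [Algebra (MvPolynomial ι ℝ) K]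
    [IsFractionRing (MvPolynomial ι ℝ) K] (p : MvPolynomial ι ℝ) {d : ℕ}
    (hp : MvPolynomial.constantCoeff p = 1) (hdeg : p.totalDegree = d) (hsq : Squarefree p)
    {q : MvPolynomial ι ℝ} (hq : q ≠ 0) {k : ℕ} (Q : Matrix (Fin k) (Fin d) (MvPolynomial ι ℝ))
    (hQ : Qᵀ * Q = q ^ 2 • paramHermite p d) :
    ∃ (r : ℕ) (q' : MvPolynomial ι ℝ) (Q' : Matrix (Fin k) (Fin d) (MvPolynomial ι ℝ)),
      q'.IsHomogeneous r ∧ q' ≠ 0 ∧ Q'ᵀ * Q' = q' ^ 2 • paramHermite p d ∧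
      (ratRep K p d q' Q').IsSymm ∧
      (∀ i j, IsHomogeneousRat (algebraMap (MvPolynomial ι ℝ) K) (ratRep K p d q' Q' i j) 1) ∧
      (1 - ratRep K p d q' Q').det = algebraMap (MvPolynomial ι ℝ) K p := by
  obtain ⟨r, q', Q', hq'h, hq'0, hQ'h, hQ'⟩ := lemma_2_1_of_decomposition p d hq Q hQ
  exact ⟨r, q', Q', hq'h, hq'0, hQ', ratRep_isSymm K p hp hdeg hsq q' Q',
    fun i j => thm_3_1_isHomogeneousRat K p d hq'h Q' hQ'h i j,
    det_one_sub_ratRep K p hp hdeg hsq hq'0 Q' hQ'⟩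

/-- **NPT 2013, Theorem of the Introduction, relative to a decomposition `q²𝓗(p) = 𝒬ᵀ𝒬`** («there
is a symmetric matrix `𝓜` with rational, homogeneous of degree-one entries such that
`p = det(I + 𝓜)`»): take `𝓜 := −q'⁻²𝒬'𝓛_t𝓗(p)⁻¹𝒬'ᵀ` from Thm. 3.1.  The real-zero hypothesis of the
source enters only through the existence of the decomposition (Gondard–Ribenboim, not formalised),
which is taken as a hypothesis here. [cite: NetzerPlaumannThom2013, Introduction (Theorem) and Thm. 3.1] -/
theorem intro_theorem_of_decomposition (K : Type*) [Field K] [Algebra (MvPolynomial ι ℝ) K]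
    [IsFractionRing (MvPolynomial ι ℝ) K] (p : MvPolynomial ι ℝ) {d : ℕ}
    (hp : MvPolynomial.constantCoeff p = 1) (hdeg : p.totalDegree = d) (hsq : Squarefree p)
    {q : MvPolynomial ι ℝ} (hq : q ≠ 0) {k : ℕ} (Q : Matrix (Fin k) (Fin d) (MvPolynomial ι ℝ))
    (hQ : Qᵀ * Q = q ^ 2 • paramHermite p d) :
    ∃ M : Matrix (Fin k) (Fin k) K, M.IsSymm ∧
      (∀ i j, IsHomogeneousRat (algebraMap (MvPolynomial ι ℝ) K) (M i j) 1) ∧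
      (1 + M).det = algebraMap (MvPolynomial ι ℝ) K p := by
  obtain ⟨r, q', Q', -, -, -, hsymm, hhom, hdet⟩ := thm_3_1 K p hp hdeg hsq hq Q hQ
  refine ⟨-ratRep K p d q' Q', hsymm.neg, fun i j => ?_, by rw [← sub_eq_add_neg, hdet]⟩
  rw [Matrix.neg_apply]
  exact (hhom i j).neg

end Thm31Degree

end Literature.AlgebraicGeometry.DeterminantalHypersurfaces.NetzerPlaumannThom2013
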